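import Literature.MathematicalPhysics.QuantumFieldTheory.Balaban1983to89.B9Eq370LetterConversionL2
import Literature.Analysis.Complex.RungeUnits

/-!
# `Balaban1983to89.B9Eq370SecondOrderConversionL2` — print's «∇_U ↦ ∇_{U′U}» conversion (p. 403 l.1–9, (3.70)/(3.74)) for the
# SECOND-ORDER (3.46) members `∇_{U′U}∇_{U′U}G`, `G∇*_{U′U}∇*_{U′U}` in the block-`ℓ²` currency: the commutator of a difference letter with a
# transport-defect letter is a LOCAL letter of size `O(1)·α₁·(Lʲη)⁻²`, by (3.37) second clause and the plaquette smallness of the background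

T. Bałaban, *Propagators for lattice gauge theories in a background field*, Commun. Math. Phys. **99** (1985) 389–434
[`Balaban1985BackgroundPropagators`, "B9"]; [4] = T. Bałaban, *Propagators and renormalization transformations for lattice gauge
theories. II*, Commun. Math. Phys. **96** (1984) 223–250 [`Balaban1984PropagatorsII`].

statement-level skeleton of published theorems with citation tags; proofs where landed; nothing here is a claim about the
Yang–Mills mass gap

THE PRINTED LOCI.  p. 403 l.1–9 («we can prove all the statements (3.42)–(3.47) of Theorem 3.1 for the operator G′(U′U), of course with different
constants, although changes are small»); (3.70) p. 404, (3.74) p. 405 (`∇_{U′U} = ∇_U + (R(U′) − 1)R(U)τ`, the same for `∇*`); (3.37) p. 396 second clause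
(`|∇^η_U A| < α₁(Lʲη)⁻²`); p. 404 after (3.69) («|Re(U′U)(∂p) − 1|, |Im(U′U)(∂p)| ≦ O(1)(Mα₀ + α₁)ξ² … These estimates follow directly from (3.35), (3.37)»
— the plaquette smallness of the base, here a DISPLAYED hypothesis `hplaq` on the transports `R(U(∂p))`, cf. `B9Eq335Plaquette` for its derivation from
(3.35) on a cube of the class); Theorem 3.1 (3.46) p. 398; [4] Prop. 2.6 (2.140)–(2.141) p. 247, Lemma 2.1 p. 234.

WHY THIS FILE (pub-ymgap N06 row 13, seat dag-n06-c gen 9).  `B9Eq370LetterConversionL2` converts (3.46) members with ONE difference letter on a side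
(`∇G`, `G∇*`, `∇G∇*`): the defect `E_k = ∇♯_{U′U,k} − ∇♯_{U,k}` is a local letter of size `O(1)α₁(Lʲη)⁻¹` and `E_k·(∇G)`, `(G∇*)·E_k` compose by
[4] (2.141).  For TWO differences on one side, `∇^W_k∇^W_l G = ∇_k∇_l G + E_l·(∇_k G) + [∇_k, E_l]·G + E_k·(∇^W_l G)`, and the new object is the
commutator `[∇_k, E_l]`: a local letter reading ONE neighbour `x + e_k + e_l`, whose size is NOT `η⁻¹·O(α₁(Lʲη)⁻¹)` but `O(1)α₁(Lʲη)⁻²`, because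
(i) the Leibniz defect of `∇_k` on the multiplier `R(U′_l) − 1` is `η⁻¹(R(Ad_{U_k(x)}U′_l(x+e_k)) − R(U′_l(x)))`, of size `η⁻¹·η·|∇_{U,k}(ηA_l)| ≦ ηα₁(Lʲη)⁻²`
by (3.37) second clause, and (ii) the commutator of the two transport-shifts is `η⁻¹(R(U_k(x)U_l(x+e_k)) − R(U_l(x)U_k(x+e_l)))`, the plaquette of the
base, of size `η⁻¹·O(1)(η/(Lʲη))²` by the located plaquette smallness, multiplied by `‖R(U′_l) − 1‖ ≦ 4ηα₁(Lʲη)⁻¹`.  §1 proves the two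
pointwise identities (forward letters for the left member, backward letters for the right member) and their bounds; §2 makes them block-`ℓ²`
letters ([4] (2.140), multiplicity one); §3 composes: the LEFT second-order conversion `∇_k∇_l G ↦ ∇^W_k∇^W_l G` and the RIGHT one
`G∇*_k∇*_l ↦ G∇*^W_k∇*^W_l`, with explicit constants, for any `Gp` with the (3.46) entries (weights `ℓ²`, `ℓ`, `1`).
Value = bookkeeping of one sentence of print (p. 403 l.1–9) at second order; NOT summit progress; N06 is not discharged by this file.
-/

noncomputable section

namespace Literature.MathematicalPhysics.QuantumFieldTheory.Balaban1983to89.B9Eq370SecondOrderConversionL2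

open NormedSpace Complex
open Literature.MathematicalPhysics.QuantumFieldTheory.Balaban1983to89
open Literature.MathematicalPhysics.QuantumFieldTheory.Balaban1983to89.B6RandomWalk (Triangle254 Ineq261)
open Literature.MathematicalPhysics.QuantumFieldTheory.Balaban1983to89.B6RandomWalkL2 (HasL2Majorant hasL2Majorant_mono hasL2Majorant_add)
open Literature.MathematicalPhysics.QuantumFieldTheory.Balaban1983to89.B9Thm34Ext (toB6)
open Literature.MathematicalPhysics.QuantumFieldTheory.Balaban1983to89.B9Ineq347 (ScaleTransfer)
open Literature.MathematicalPhysics.QuantumFieldTheory.Balaban1983to89.B9Eq39Adjoint (R R_def R_mul R_sub R_smul R_inv_R fluct prodCfg covD covDstar)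
open Literature.MathematicalPhysics.QuantumFieldTheory.Balaban1983to89.B9Eq369Product (val_fluct val_inv_fluct)
open Literature.MathematicalPhysics.QuantumFieldTheory.Balaban1983to89.B9Eq370Expansion (norm_conj_sub_le norm_Iη_smul)
open Literature.MathematicalPhysics.QuantumFieldTheory.Balaban1983to89.B9Eq352ScalarFluct (exp_two_mul_le_two)
open Literature.MathematicalPhysics.QuantumFieldTheory.Balaban1983to89.B9Eq352DivForm (tauB)
open Literature.MathematicalPhysics.QuantumFieldTheory.Balaban1983to89.B9Eq352DivFormLetters (conj conj_sub conj_mul gradLetterF_apply gradLetterB_apply)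
open Literature.MathematicalPhysics.QuantumFieldTheory.Balaban1983to89.B9Eq352GradLetters (diffLetter diffLetter_inl diffLetter_inr)
open Literature.MathematicalPhysics.QuantumFieldTheory.Balaban1983to89.B9Ineq361L2Letters (hasL2Majorant_conj_of_local)
open Literature.MathematicalPhysics.QuantumFieldTheory.Balaban1983to89.B9Ineq363L2 (hasL2Majorant_comp_decay hasL2Majorant_rate_mono)
open Literature.MathematicalPhysics.QuantumFieldTheory.Balaban1983to89.B9Eq370LetterConversion (diffLetter_prodCfg_sub_apply_inl diffLetter_prodCfg_sub_apply_inr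
  exp_two_mul_sub_one_le)
open Literature.MathematicalPhysics.QuantumFieldTheory.Balaban1983to89.B9Eq370LetterConversionL2 (hasL2Majorant_diffLetter_prodCfg_sub
  hasL2Majorant_diffLetter_prodCfg_mul hasL2Majorant_mul_diffLetter_prodCfg)

/-! ## §0  Scalar and algebra helpers -/

section Helpers

/-- `e^{1/4} ≦ 2` and `e^{1/2} ≦ 2` (the numerical range of `ηα₁ℓ⁻¹ ≦ 1/4`). [cite: Balaban1985BackgroundPropagators, (3.37) p.396, bookkeeping] -/
theorem exp_quarter_le_two : Real.exp (1 / 4) ≤ 2 ∧ Real.exp (1 / 2) ≤ 2 := by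
  have h2 : Real.exp (1 / 2) ≤ 2 := by
    have h := exp_two_mul_le_two (t := 1 / 4) le_rfl
    norm_num at h
    exact h
  exact ⟨(Real.exp_le_exp.2 (by norm_num)).trans h2, h2⟩

variable {𝔸 : Type*} [NormedRing 𝔸] [NormedAlgebra ℂ 𝔸] [CompleteSpace 𝔸]

omit [NormedAlgebra ℂ 𝔸] [CompleteSpace 𝔸] in
/-- `R(v)Z − R(u)Z = (v − u)Zv⁻¹ + uZ·v⁻¹(u − v)u⁻¹`, hence `‖R(v)Z − R(u)Z‖ ≦ ‖v⁻¹‖(1 + ‖u‖‖u⁻¹‖)·‖v − u‖·‖Z‖` (the transport `R(U)X = UXU⁻¹` of p. 390).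
[cite: Balaban1985BackgroundPropagators, p.390, bookkeeping] -/
theorem norm_R_sub_R_le' (v u : 𝔸ˣ) (Z : 𝔸) :
    ‖R v Z - R u Z‖ ≤ ‖((v⁻¹ : 𝔸ˣ) : 𝔸)‖ * (1 + ‖(u : 𝔸)‖ * ‖((u⁻¹ : 𝔸ˣ) : 𝔸)‖) * ‖(v : 𝔸) - u‖ * ‖Z‖ := by
  have hinv : ((v⁻¹ : 𝔸ˣ) : 𝔸) - ((u⁻¹ : 𝔸ˣ) : 𝔸) = ((v⁻¹ : 𝔸ˣ) : 𝔸) * ((u : 𝔸) - v) * ((u⁻¹ : 𝔸ˣ) : 𝔸) := by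
    rw [mul_sub, sub_mul, Units.inv_mul, one_mul, mul_assoc, Units.mul_inv, mul_one]
  have e : R v Z - R u Z = ((v : 𝔸) - u) * Z * ((v⁻¹ : 𝔸ˣ) : 𝔸) + (u : 𝔸) * Z * (((v⁻¹ : 𝔸ˣ) : 𝔸) - ((u⁻¹ : 𝔸ˣ) : 𝔸)) := by
    simp only [R_def]; noncomm_ring
  rw [e, hinv]
  have h1 : ‖((v : 𝔸) - u) * Z * ((v⁻¹ : 𝔸ˣ) : 𝔸)‖ ≤ ‖(v : 𝔸) - u‖ * ‖Z‖ * ‖((v⁻¹ : 𝔸ˣ) : 𝔸)‖ :=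
    (norm_mul_le _ _).trans (mul_le_mul_of_nonneg_right (norm_mul_le _ _) (norm_nonneg _))
  have h2 : ‖(u : 𝔸) * Z * (((v⁻¹ : 𝔸ˣ) : 𝔸) * ((u : 𝔸) - v) * ((u⁻¹ : 𝔸ˣ) : 𝔸))‖
      ≤ ‖(u : 𝔸)‖ * ‖Z‖ * (‖((v⁻¹ : 𝔸ˣ) : 𝔸)‖ * ‖(u : 𝔸) - v‖ * ‖((u⁻¹ : 𝔸ˣ) : 𝔸)‖) := by
    refine (norm_mul_le _ _).trans (mul_le_mul (norm_mul_le _ _) ?_ (norm_nonneg _) (by positivity))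
    exact (norm_mul_le _ _).trans (mul_le_mul_of_nonneg_right (norm_mul_le _ _) (norm_nonneg _))
  rw [norm_sub_rev (u : 𝔸) v] at h2
  calc _ ≤ _ := norm_add_le _ _
    _ ≤ ‖(v : 𝔸) - u‖ * ‖Z‖ * ‖((v⁻¹ : 𝔸ˣ) : 𝔸)‖ + ‖(u : 𝔸)‖ * ‖Z‖ * (‖((v⁻¹ : 𝔸ˣ) : 𝔸)‖ * ‖(v : 𝔸) - u‖ * ‖((u⁻¹ : 𝔸ˣ) : 𝔸)‖) :=
        add_le_add h1 h2
    _ = _ := by ring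

omit [NormedAlgebra ℂ 𝔸] [CompleteSpace 𝔸] in
/-- `R(a)⁻¹Z − R(b)⁻¹Z = R(a⁻¹)(R(b)W − R(a)W)` with `W = R(b⁻¹)Z`: the inverse-transport difference through the direct one; in norm, for transports of
norm `≦ 1`, `‖R(a⁻¹)Z − R(b⁻¹)Z‖ ≦ sup_W ‖R(a)W − R(b)W‖/‖W‖·‖Z‖`. [cite: Balaban1985BackgroundPropagators, p.390, (3.5) p.391, bookkeeping] -/
theorem R_inv_sub_R_inv (a b : 𝔸ˣ) (Z : 𝔸) : R a⁻¹ Z - R b⁻¹ Z = R a⁻¹ (R b (R b⁻¹ Z) - R a (R b⁻¹ Z)) := by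
  rw [R_sub, R_inv_R, ← B9Eq39Adjoint.R_mul b b⁻¹ Z, mul_inv_cancel, B9Eq39Adjoint.R_one]

omit [CompleteSpace 𝔸] in
/-- `‖η⁻¹·X‖ = η⁻¹‖X‖` (`η > 0`; the normalisation of (3.37)). [cite: Balaban1985BackgroundPropagators, (3.37) p.396, bookkeeping] -/
theorem norm_inv_smul' {η : ℝ} (hη : 0 < η) (X : 𝔸) : ‖((η : ℂ))⁻¹ • X‖ = η⁻¹ * ‖X‖ := by
  rw [norm_smul, norm_inv, Complex.norm_real, Real.norm_eq_abs, abs_of_pos hη]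

omit [CompleteSpace 𝔸] in
/-- from the (3.37)-normalised bound `‖η⁻¹·X‖ ≦ B` back to `‖X‖ ≦ ηB`. [cite: Balaban1985BackgroundPropagators, (3.37) p.396, bookkeeping] -/
theorem norm_le_of_norm_inv_smul_le {η : ℝ} (hη : 0 < η) {X : 𝔸} {B : ℝ} (h : ‖((η : ℂ))⁻¹ • X‖ ≤ B) : ‖X‖ ≤ η * B := by
  rw [norm_inv_smul' hη] at h
  rwa [inv_mul_le_iff₀ hη] at h

end Helpers

section Neg

open Literature.MathematicalPhysics.QuantumFieldTheory.Balaban1983to89.B6RandomWalk (blockPiece)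
open Literature.MathematicalPhysics.QuantumFieldTheory.Balaban1983to89.B6RandomWalkL2 (l2n_smul)

/-- an `L²` majorant of `T` is one of `−T`. [cite: Balaban1984PropagatorsII, (2.52) p.232 (bookkeeping, ours)] -/
theorem hasL2Majorant_neg {G : B6.Geometry} {X : Type} [Fintype X] (blk : X → G.Site) {L : Module.End ℝ (X → ℝ)} {K : G.Site → G.Site → ℝ}
    (h : HasL2Majorant blk L K) : HasL2Majorant blk (-L) K := by
  intro y y' u hu
  have e : blockPiece blk y ((-L) u) = (-1 : ℝ) • blockPiece blk y (L u) := by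
    funext x
    by_cases hx : blk x = y <;> simp [blockPiece, hx]
  rw [e, l2n_smul, abs_neg, abs_one, one_mul]
  exact h y y' u hu

end Neg

/-! ## §1  The commutator of a difference letter with a transport-defect letter, pointwise -/

section Pointwise

variable {𝔸 : Type*} [NormedRing 𝔸] [NormedAlgebra ℂ 𝔸] [CompleteSpace 𝔸] [NormOneClass 𝔸] {S : Type} {κ : Type}
variable (T : κ → Equiv.Perm S) (U : κ → S → 𝔸ˣ) {g : B9.Geometry}

omit [NormOneClass 𝔸] in
/-- ★ **THE FORWARD COMMUTATOR `[∇♯_{U,k}, E_l]`, `E_l = ∇♯_{U′U,l} − ∇♯_{U,l}`, WRITTEN OUT** (`c = η⁻¹`, `U′_l = e^{iηA_l}`): it reads the single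
neighbour `x + e_k + e_l` —
`([∇♯_k, E_l]Ψ)(x) = c²·(R(U_k(x))R(U′_l(x+e_k))R(U_l(x+e_k))Ψ(x+e_k+e_l) − R(U_k(x))R(U_l(x+e_k))Ψ(x+e_k+e_l) − R(U′_l(x))R(U_l(x))R(U_k(x+e_l))Ψ(x+e_l+e_k) + R(U_l(x))R(U_k(x+e_l))Ψ(x+e_l+e_k))`
(the `Ψ(x+e_l)` terms of the two products cancel). [cite: Balaban1985BackgroundPropagators, (3.70) p.404, (3.3) p.390] -/
theorem comm_diffLetter_defect_apply_inl (η : ℝ) (c : ℂ) (A : κ → S → 𝔸) (k l : κ) (Ψ : S → 𝔸) (x : S) :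
    (diffLetter T U c (Sum.inl k) * (diffLetter T (prodCfg U η A) c (Sum.inl l) - diffLetter T U c (Sum.inl l))
        - (diffLetter T (prodCfg U η A) c (Sum.inl l) - diffLetter T U c (Sum.inl l)) * diffLetter T U c (Sum.inl k)) Ψ x
      = (c * c) • (R (U k x) (R (fluct η A l (T k x)) (R (U l (T k x)) (Ψ (T l (T k x)))))
          - R (U k x) (R (U l (T k x)) (Ψ (T l (T k x))))
          - R (fluct η A l x) (R (U l x) (R (U k (T l x)) (Ψ (T k (T l x)))))
          + R (U l x) (R (U k (T l x)) (Ψ (T k (T l x))))) := by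
  rw [LinearMap.sub_apply, Pi.sub_apply, Module.End.mul_apply, Module.End.mul_apply,
    diffLetter_prodCfg_sub_apply_inl (lam := diffLetter T U c (Sum.inl k) Ψ), diffLetter_inl, gradLetterF_apply, gradLetterF_apply]
  simp only [covD, diffLetter_prodCfg_sub_apply_inl, R_sub, R_smul, smul_add, smul_sub, smul_smul]
  abel

/-- ★ **THE FORWARD COMMUTATOR IS `O(1)·α₁(Lʲη)⁻²` POINTWISE.**  With commuting shifts (`x + e_k + e_l = x + e_l + e_k`), transports of norm `≦ 1`,
(3.37) blockwise (`‖A_l‖ ≦ α₁ℓ⁻¹` at `x` and `x + e_k`, `‖η⁻¹∇_{U,k}A_l(x)‖ ≦ α₁ℓ(y(x))⁻²`), `ηα₁ℓ⁻¹ ≦ 1/4` on every block, `η ≦ ℓ(y(x))`, and the plaquette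
smallness of the base at `x` in the transported form `‖R(U_k(x)U_l(x+e_k))X − R(U_l(x)U_k(x+e_l))X‖ ≦ c_P(η/ℓ(y(x)))²‖X‖`:
`‖([∇♯_k, E_l]Ψ)(x)‖ ≦ (12 + 4c_P)·α₁·ℓ(y(x))⁻²·‖Ψ(x+e_k+e_l)‖` — the Leibniz defect `R(Ad_{U_k}U′_l(x+e_k)) − R(U′_l(x))` is `≦ 12η²α₁ℓ⁻²`
(`e^{1/4} ≦ 2`), the shift commutator costs `(e^{2η|A_l|} − 1)·c_P(η/ℓ)² ≦ 4ηα₁ℓ⁻¹·c_P(η/ℓ)²`, and `c² = η⁻²`.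
[cite: Balaban1985BackgroundPropagators, p.403 l.1–9, (3.70) p.404, (3.37) p.396, p.404 after (3.69)] -/
theorem norm_comm_diffLetter_defect_apply_inl_le (blk : S → g.Site) {η : ℝ} (hη : 0 < η) (A : κ → S → 𝔸) {α₁ cP : ℝ}
    (hα₁ : 0 ≤ α₁) (hcP : 0 ≤ cP) (k l : κ) (x : S) (hcomm : T l (T k x) = T k (T l x))
    (hρu : ∀ μ y, ‖((U μ y : 𝔸ˣ) : 𝔸)‖ ≤ 1 ∧ ‖(((U μ y)⁻¹ : 𝔸ˣ) : 𝔸)‖ ≤ 1)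
    (hsmall : ∀ y : g.Site, η * (α₁ * (g.len y)⁻¹) ≤ 1 / 4) (hlen : ∀ y : g.Site, 0 < g.len y)
    (hA1 : ∀ μ y, ‖A μ y‖ ≤ α₁ * (g.len (blk y))⁻¹)
    (hA2 : ‖((η : ℂ))⁻¹ • covD T U k (A l) x‖ ≤ α₁ * (g.len (blk x) ^ 2)⁻¹)
    (hplaq : ∀ X : 𝔸, ‖R (U k x * U l (T k x)) X - R (U l x * U k (T l x)) X‖ ≤ cP * (η * (g.len (blk x))⁻¹) ^ 2 * ‖X‖)
    (heta : η ≤ g.len (blk x)) (Ψ : S → 𝔸) :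
    ‖(diffLetter T U (((η : ℂ))⁻¹) (Sum.inl k) * (diffLetter T (prodCfg U η A) (((η : ℂ))⁻¹) (Sum.inl l) - diffLetter T U (((η : ℂ))⁻¹) (Sum.inl l))
        - (diffLetter T (prodCfg U η A) (((η : ℂ))⁻¹) (Sum.inl l) - diffLetter T U (((η : ℂ))⁻¹) (Sum.inl l))
            * diffLetter T U (((η : ℂ))⁻¹) (Sum.inl k)) Ψ x‖
      ≤ (12 + 4 * cP) * α₁ * ((g.len (blk x))⁻¹) ^ 2 * ‖Ψ (T k (T l x))‖ := by
  rw [comm_diffLetter_defect_apply_inl, hcomm]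
  rw [← inv_pow] at hA2
  have hℓ0 : 0 < g.len (blk x) := hlen _
  have hℓi0 : 0 ≤ (g.len (blk x))⁻¹ := inv_nonneg.mpr hℓ0.le
  have hηℓ : η * (g.len (blk x))⁻¹ ≤ 1 := by rw [mul_inv_le_iff₀ hℓ0, one_mul]; exact heta
  have hηℓ0 : 0 ≤ η * (g.len (blk x))⁻¹ := mul_nonneg hη.le hℓi0
  obtain ⟨he4, he2⟩ := exp_quarter_le_two
  -- the two transports of the plaquette and the conjugated fluctuation unit
  have hF : R (U k x) (R (fluct η A l (T k x)) (R (U l (T k x)) (Ψ (T k (T l x))))) - R (U k x) (R (U l (T k x)) (Ψ (T k (T l x))))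
        - R (fluct η A l x) (R (U l x) (R (U k (T l x)) (Ψ (T k (T l x))))) + R (U l x) (R (U k (T l x)) (Ψ (T k (T l x))))
      = (R (U k x * fluct η A l (T k x) * (U k x)⁻¹) (R (U k x * U l (T k x)) (Ψ (T k (T l x))))
            - R (fluct η A l x) (R (U k x * U l (T k x)) (Ψ (T k (T l x)))))
        + (R (fluct η A l x) (R (U k x * U l (T k x)) (Ψ (T k (T l x))) - R (U l x * U k (T l x)) (Ψ (T k (T l x))))
            - (R (U k x * U l (T k x)) (Ψ (T k (T l x))) - R (U l x * U k (T l x)) (Ψ (T k (T l x))))) := by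
    have h1 : R (U k x * fluct η A l (T k x) * (U k x)⁻¹) (R (U k x * U l (T k x)) (Ψ (T k (T l x))))
        = R (U k x) (R (fluct η A l (T k x)) (R (U l (T k x)) (Ψ (T k (T l x))))) := by
      rw [← B9Eq39Adjoint.R_mul, show U k x * fluct η A l (T k x) * (U k x)⁻¹ * (U k x * U l (T k x))
        = U k x * (fluct η A l (T k x) * U l (T k x)) by group, B9Eq39Adjoint.R_mul, B9Eq39Adjoint.R_mul]
    rw [h1, B9Eq39Adjoint.R_mul, B9Eq39Adjoint.R_mul, R_sub]
    abel
  rw [hF]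
  -- from here on: `Y = Ψ(x+e_k+e_l)`, `Z = R(U_k(x)U_l(x+e_k))Y`, `Z₂ = R(U_l(x)U_k(x+e_l))Y`, `u = U′_l(x)`, `v = Ad_{U_k(x)}U′_l(x+e_k)`
  generalize hY : Ψ (T k (T l x)) = Y
  set Z : 𝔸 := R (U k x * U l (T k x)) Y with hZ
  set Z₂ : 𝔸 := R (U l x * U k (T l x)) Y with hZ₂
  set u : 𝔸ˣ := fluct η A l x with hu
  set v : 𝔸ˣ := U k x * fluct η A l (T k x) * (U k x)⁻¹ with hv
  set ℓx : ℝ := g.len (blk x) with hℓx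
  -- the exponents
  set X : 𝔸 := ((I * η : ℂ)) • A l x with hX
  set X' : 𝔸 := ((I * η : ℂ)) • A l (T k x) with hX'
  set P : 𝔸 := ((U k x : 𝔸ˣ) : 𝔸) * X' * (((U k x)⁻¹ : 𝔸ˣ) : 𝔸) with hP
  have hXn : ‖X‖ ≤ 1 / 4 := by
    rw [hX, norm_Iη_smul hη.le]
    exact (mul_le_mul_of_nonneg_left (hA1 l x) hη.le).trans (hsmall _)
  have hX'n : ‖X'‖ ≤ 1 / 4 := by
    rw [hX', norm_Iη_smul hη.le]
    exact (mul_le_mul_of_nonneg_left (hA1 l (T k x)) hη.le).trans (hsmall _)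
  have hPn : ‖P‖ ≤ 1 / 4 := by
    calc ‖P‖ ≤ ‖((U k x : 𝔸ˣ) : 𝔸)‖ * ‖X'‖ * ‖(((U k x)⁻¹ : 𝔸ˣ) : 𝔸)‖ :=
          (norm_mul_le _ _).trans (mul_le_mul_of_nonneg_right (norm_mul_le _ _) (norm_nonneg _))
      _ ≤ 1 * ‖X'‖ * 1 := by
          gcongr
          · exact (hρu k x).1
          · exact (hρu k x).2
      _ ≤ 1 / 4 := by rw [one_mul, mul_one]; exact hX'n
  -- the units as exponentials
  have hu_val : (u : 𝔸) = exp X := by rw [hu, val_fluct]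
  have hu_inv : ((u⁻¹ : 𝔸ˣ) : 𝔸) = exp (-X) := by rw [hu, val_inv_fluct]
  have hv_val : (v : 𝔸) = exp P := by
    rw [hv, Units.val_mul, Units.val_mul, val_fluct, hP, B12Membership314.exp_units_conj']
  have hv_inv : ((v⁻¹ : 𝔸ˣ) : 𝔸) = exp (-P) := by
    rw [hv, mul_inv_rev, mul_inv_rev, inv_inv, Units.val_mul, Units.val_mul, val_inv_fluct, hP, ← mul_assoc,
      B12Membership314.exp_neg_units_conj']
  have hun : ‖(u : 𝔸)‖ ≤ Real.exp (1 / 4) := by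
    rw [hu_val]; exact (Literature.Analysis.Complex.norm_exp_le_exp_norm X).trans (Real.exp_le_exp.2 hXn)
  have huin : ‖((u⁻¹ : 𝔸ˣ) : 𝔸)‖ ≤ Real.exp (1 / 4) := by
    rw [hu_inv]
    exact (Literature.Analysis.Complex.norm_exp_le_exp_norm (-X)).trans (Real.exp_le_exp.2 (by rw [norm_neg]; exact hXn))
  have huu : ‖(u : 𝔸)‖ * ‖((u⁻¹ : 𝔸ˣ) : 𝔸)‖ ≤ 2 := by
    refine (mul_le_mul hun huin (norm_nonneg _) (Real.exp_pos _).le).trans ?_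
    rw [← Real.exp_add]; norm_num; exact he2
  have hvin : ‖((v⁻¹ : 𝔸ˣ) : 𝔸)‖ ≤ 2 := by
    rw [hv_inv]
    exact (Literature.Analysis.Complex.norm_exp_le_exp_norm (-P)).trans ((Real.exp_le_exp.2 (by rw [norm_neg]; exact hPn)).trans he4)
  -- `P − X = iη·∇_{U,k}A_l(x)`, so `‖v − u‖ ≦ η·(ηα₁ℓ⁻²)·2`
  have hPX : P - X = ((I * η : ℂ)) • covD T U k (A l) x := by
    rw [covD, smul_sub, ← R_smul, hP, hX', R_def]
  have hcov : ‖covD T U k (A l) x‖ ≤ η * (α₁ * ℓx⁻¹ ^ 2) := norm_le_of_norm_inv_smul_le hη hA2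
  have hvu : ‖(v : 𝔸) - u‖ ≤ η * (η * (α₁ * ℓx⁻¹ ^ 2)) * 2 := by
    rw [hv_val, hu_val]
    refine (Literature.Analysis.Complex.norm_exp_sub_exp_le P X).trans ?_
    rw [hPX, norm_Iη_smul hη.le]
    exact mul_le_mul (mul_le_mul_of_nonneg_left hcov hη.le) ((Real.exp_le_exp.2 (max_le hPn hXn)).trans he4) (Real.exp_pos _).le
      (by positivity)
  -- `‖Z‖ ≦ ‖Y‖`
  have hZn : ‖Z‖ ≤ ‖Y‖ := by
    have h1 : ‖((U k x * U l (T k x) : 𝔸ˣ) : 𝔸)‖ ≤ 1 := by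
      rw [Units.val_mul]
      exact (norm_mul_le _ _).trans (mul_le_one₀ (hρu k x).1 (norm_nonneg _) (hρu l (T k x)).1)
    have h2 : ‖(((U k x * U l (T k x))⁻¹ : 𝔸ˣ) : 𝔸)‖ ≤ 1 := by
      rw [mul_inv_rev, Units.val_mul]
      exact (norm_mul_le _ _).trans (mul_le_one₀ (hρu l (T k x)).2 (norm_nonneg _) (hρu k x).2)
    have := B9Eq371Composition.norm_R_le_sq (U k x * U l (T k x)) h1 h2 Y
    rwa [one_pow, one_mul] at this
  -- (i) the Leibniz defect term
  have hi : ‖R v Z - R u Z‖ ≤ (η * η) * (12 * (α₁ * ℓx⁻¹ ^ 2) * ‖Y‖) := by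
    refine (norm_R_sub_R_le' v u Z).trans ?_
    have h5 : ‖((v⁻¹ : 𝔸ˣ) : 𝔸)‖ * (1 + ‖(u : 𝔸)‖ * ‖((u⁻¹ : 𝔸ˣ) : 𝔸)‖) ≤ 2 * (1 + 2) :=
      mul_le_mul hvin (by linarith) (by positivity) (by norm_num)
    calc ‖((v⁻¹ : 𝔸ˣ) : 𝔸)‖ * (1 + ‖(u : 𝔸)‖ * ‖((u⁻¹ : 𝔸ˣ) : 𝔸)‖) * ‖(v : 𝔸) - u‖ * ‖Z‖
        ≤ (2 * (1 + 2)) * (η * (η * (α₁ * ℓx⁻¹ ^ 2)) * 2) * ‖Y‖ :=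
          mul_le_mul (mul_le_mul h5 hvu (norm_nonneg _) (by positivity)) hZn (norm_nonneg _) (by positivity)
      _ = _ := by ring
  -- (ii) the shift-commutator term
  have hii : ‖R u (Z - Z₂) - (Z - Z₂)‖ ≤ (η * η) * (4 * cP * (η * ℓx⁻¹) * (α₁ * ℓx⁻¹ ^ 2) * ‖Y‖) := by
    have hW : ‖Z - Z₂‖ ≤ cP * (η * ℓx⁻¹) ^ 2 * ‖Y‖ := hplaq Y
    have hc : R u (Z - Z₂) = exp X * (Z - Z₂) * exp (-X) := by rw [R_def, hu_val, hu_inv]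
    rw [hc]
    refine (norm_conj_sub_le X (Z - Z₂)).trans ?_
    have h4 : Real.exp (2 * ‖X‖) - 1 ≤ 4 * (η * (α₁ * ℓx⁻¹)) := by
      refine (exp_two_mul_sub_one_le (norm_nonneg _) hXn).trans ?_
      rw [hX, norm_Iη_smul hη.le]
      exact mul_le_mul_of_nonneg_left (mul_le_mul_of_nonneg_left (hA1 l x) hη.le) (by norm_num)
    calc (Real.exp (2 * ‖X‖) - 1) * ‖Z - Z₂‖ ≤ (4 * (η * (α₁ * ℓx⁻¹))) * (cP * (η * ℓx⁻¹) ^ 2 * ‖Y‖) :=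
          mul_le_mul h4 hW (norm_nonneg _) (by positivity)
      _ = _ := by ring
  -- assembling with `‖c²‖ = η⁻²`
  rw [norm_smul, norm_mul, norm_inv, Complex.norm_real, Real.norm_eq_abs, abs_of_pos hη]
  have hη2 : η⁻¹ * η⁻¹ * (η * η) = 1 := by
    rw [← mul_inv, inv_mul_cancel₀ (mul_ne_zero hη.ne' hη.ne')]
  have hsum := (norm_add_le (R v Z - R u Z) (R u (Z - Z₂) - (Z - Z₂))).trans (add_le_add hi hii)
  have hY0 : 0 ≤ α₁ * ℓx⁻¹ ^ 2 * ‖Y‖ := by positivity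
  calc η⁻¹ * η⁻¹ * ‖R v Z - R u Z + (R u (Z - Z₂) - (Z - Z₂))‖
      ≤ η⁻¹ * η⁻¹ * ((η * η) * (12 * (α₁ * ℓx⁻¹ ^ 2) * ‖Y‖) + (η * η) * (4 * cP * (η * ℓx⁻¹) * (α₁ * ℓx⁻¹ ^ 2) * ‖Y‖)) :=
        mul_le_mul_of_nonneg_left hsum (by positivity)
    _ = 12 * (α₁ * ℓx⁻¹ ^ 2 * ‖Y‖) + 4 * cP * (η * ℓx⁻¹) * (α₁ * ℓx⁻¹ ^ 2 * ‖Y‖) := by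
        rw [← mul_add, ← mul_assoc, hη2, one_mul]; ring
    _ ≤ 12 * (α₁ * ℓx⁻¹ ^ 2 * ‖Y‖) + 4 * cP * 1 * (α₁ * ℓx⁻¹ ^ 2 * ‖Y‖) := by gcongr
    _ = (12 + 4 * cP) * α₁ * ℓx⁻¹ ^ 2 * ‖Y‖ := by ring

omit [NormOneClass 𝔸] in
/-- **the backward defect in unit form**: `(E*_lΦ)(x) = −c·(R(U_l(y))⁻¹R(U′_l(y))⁻¹Φ(y) − R(U_l(y))⁻¹Φ(y))`, `y = x − e_l` ((3.74): `(U′U)⁻¹ = U⁻¹U′⁻¹`).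
[cite: Balaban1985BackgroundPropagators, (3.74) p.405, (3.8) p.392] -/
theorem defect_apply_inr (η : ℝ) (c : ℂ) (A : κ → S → 𝔸) (l : κ) (Φ : S → 𝔸) (x : S) :
    (diffLetter T (prodCfg U η A) c (Sum.inr l) - diffLetter T U c (Sum.inr l)) Φ x
      = -(c • (R (U l ((T l).symm x))⁻¹ (R (fluct η A l ((T l).symm x))⁻¹ (Φ ((T l).symm x))) - R (U l ((T l).symm x))⁻¹ (Φ ((T l).symm x)))) := by
  rw [LinearMap.sub_apply, Pi.sub_apply, diffLetter_inr, diffLetter_inr, LinearMap.neg_apply, LinearMap.neg_apply, Pi.neg_apply, Pi.neg_apply,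
    gradLetterB_apply, gradLetterB_apply]
  simp only [covDstar, prodCfg, mul_inv_rev, B9Eq39Adjoint.R_mul, smul_sub]
  abel

omit [NormOneClass 𝔸] in
/-- ★ **THE BACKWARD COMMUTATOR `[∇♯_{U,inr k}, E*_l]`, `E*_l = ∇♯_{U′U,inr l} − ∇♯_{U,inr l}`, WRITTEN OUT** (`y_k = x − e_k`, `y_l = x − e_l`, `z = y_k − e_l`,
`z′ = y_l − e_k`): `([∇♯_{inr k}, E*_l]Φ)(x) = c²·(R(U_k(y_k))⁻¹R(U_l(z))⁻¹R(U′_l(z))⁻¹Φ(z) − R(U_k(y_k))⁻¹R(U_l(z))⁻¹Φ(z) − R(U_l(y_l))⁻¹R(U′_l(y_l))⁻¹R(U_k(z′))⁻¹Φ(z′)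
+ R(U_l(y_l))⁻¹R(U_k(z′))⁻¹Φ(z′))`. [cite: Balaban1985BackgroundPropagators, (3.74) p.405, (3.8) p.392] -/
theorem comm_diffLetter_defect_apply_inr (η : ℝ) (c : ℂ) (A : κ → S → 𝔸) (k l : κ) (Φ : S → 𝔸) (x : S) :
    (diffLetter T U c (Sum.inr k) * (diffLetter T (prodCfg U η A) c (Sum.inr l) - diffLetter T U c (Sum.inr l))
        - (diffLetter T (prodCfg U η A) c (Sum.inr l) - diffLetter T U c (Sum.inr l)) * diffLetter T U c (Sum.inr k)) Φ x
      = (c * c) • (R (U k ((T k).symm x))⁻¹ (R (U l ((T l).symm ((T k).symm x)))⁻¹ (R (fluct η A l ((T l).symm ((T k).symm x)))⁻¹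
              (Φ ((T l).symm ((T k).symm x)))))
          - R (U k ((T k).symm x))⁻¹ (R (U l ((T l).symm ((T k).symm x)))⁻¹ (Φ ((T l).symm ((T k).symm x))))
          - R (U l ((T l).symm x))⁻¹ (R (fluct η A l ((T l).symm x))⁻¹ (R (U k ((T k).symm ((T l).symm x)))⁻¹ (Φ ((T k).symm ((T l).symm x)))))
          + R (U l ((T l).symm x))⁻¹ (R (U k ((T k).symm ((T l).symm x)))⁻¹ (Φ ((T k).symm ((T l).symm x))))) := by
  rw [LinearMap.sub_apply, Pi.sub_apply, Module.End.mul_apply, Module.End.mul_apply,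
    defect_apply_inr (Φ := diffLetter T U c (Sum.inr k) Φ), diffLetter_inr, LinearMap.neg_apply, LinearMap.neg_apply, Pi.neg_apply, Pi.neg_apply,
    gradLetterB_apply, gradLetterB_apply]
  simp only [covDstar, defect_apply_inr, R_sub, R_smul, smul_add, smul_sub, neg_sub, smul_smul]
  abel

/-- ★ **THE BACKWARD COMMUTATOR IS `O(1)·α₁(Lʲη)⁻²` POINTWISE**, with the sizes read at the far point `z = x − e_k − e_l` (commuting shifts:
`z = z′`, `z + e_k = x − e_l`, `z + e_l = x − e_k`): transports of norm `≦ 1`, (3.37) blockwise (`‖A_l‖ ≦ α₁ℓ⁻¹` at `z` and `z + e_k`,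
`‖η⁻¹∇_{U,k}A_l(z)‖ ≦ α₁ℓ(y(z))⁻²`), `ηα₁ℓ⁻¹ ≦ 1/4` on every block, `η ≦ ℓ(y(z))`, and the plaquette smallness of the base AT `z`:
`‖([∇♯_{inr k}, E*_l]Φ)(x)‖ ≦ (12 + 4c_P)·α₁·ℓ(y(z))⁻²·‖Φ(z)‖`.
[cite: Balaban1985BackgroundPropagators, p.403 l.1–9, (3.74) p.405, (3.37) p.396, p.404 after (3.69)] -/
theorem norm_comm_diffLetter_defect_apply_inr_le (blk : S → g.Site) {η : ℝ} (hη : 0 < η) (A : κ → S → 𝔸) {α₁ cP : ℝ}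
    (hα₁ : 0 ≤ α₁) (hcP : 0 ≤ cP) (k l : κ) (x : S)
    (hcomm : (T k).symm ((T l).symm x) = (T l).symm ((T k).symm x))
    (hk : T k ((T l).symm ((T k).symm x)) = (T l).symm x) (hl : T l ((T l).symm ((T k).symm x)) = (T k).symm x)
    (hρu : ∀ μ y, ‖((U μ y : 𝔸ˣ) : 𝔸)‖ ≤ 1 ∧ ‖(((U μ y)⁻¹ : 𝔸ˣ) : 𝔸)‖ ≤ 1)
    (hsmall : ∀ y : g.Site, η * (α₁ * (g.len y)⁻¹) ≤ 1 / 4) (hlen : ∀ y : g.Site, 0 < g.len y)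
    (hA1 : ∀ μ y, ‖A μ y‖ ≤ α₁ * (g.len (blk y))⁻¹)
    (hA2 : ‖((η : ℂ))⁻¹ • covD T U k (A l) ((T l).symm ((T k).symm x))‖ ≤ α₁ * (g.len (blk ((T l).symm ((T k).symm x))) ^ 2)⁻¹)
    (hplaq : ∀ X : 𝔸, ‖R (U k ((T l).symm ((T k).symm x)) * U l (T k ((T l).symm ((T k).symm x)))) X
        - R (U l ((T l).symm ((T k).symm x)) * U k (T l ((T l).symm ((T k).symm x)))) X‖
        ≤ cP * (η * (g.len (blk ((T l).symm ((T k).symm x))))⁻¹) ^ 2 * ‖X‖)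
    (heta : η ≤ g.len (blk ((T l).symm ((T k).symm x)))) (Φ : S → 𝔸) :
    ‖(diffLetter T U (((η : ℂ))⁻¹) (Sum.inr k) * (diffLetter T (prodCfg U η A) (((η : ℂ))⁻¹) (Sum.inr l) - diffLetter T U (((η : ℂ))⁻¹) (Sum.inr l))
        - (diffLetter T (prodCfg U η A) (((η : ℂ))⁻¹) (Sum.inr l) - diffLetter T U (((η : ℂ))⁻¹) (Sum.inr l))
            * diffLetter T U (((η : ℂ))⁻¹) (Sum.inr k)) Φ x‖
      ≤ (12 + 4 * cP) * α₁ * ((g.len (blk ((T l).symm ((T k).symm x))))⁻¹) ^ 2 * ‖Φ ((T l).symm ((T k).symm x))‖ := by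
  rw [comm_diffLetter_defect_apply_inr, hcomm]
  rw [hk, hl] at hplaq
  rw [← inv_pow] at hA2
  -- the far point and the transports
  generalize hz : (T l).symm ((T k).symm x) = z at hplaq hA2 heta hk hl ⊢
  have hℓ0 : 0 < g.len (blk z) := hlen _
  have hℓi0 : 0 ≤ (g.len (blk z))⁻¹ := inv_nonneg.mpr hℓ0.le
  have hηℓ : η * (g.len (blk z))⁻¹ ≤ 1 := by rw [mul_inv_le_iff₀ hℓ0, one_mul]; exact heta
  have hηℓ0 : 0 ≤ η * (g.len (blk z))⁻¹ := mul_nonneg hη.le hℓi0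
  obtain ⟨he4, he2⟩ := exp_quarter_le_two
  -- `a = U_l(z)U_k(x−e_k)`, `b = U_k(z)U_l(x−e_l)` (the two paths from `z` to `x`), `u = U′_l(z)`, `v = U_k(z)U′_l(x−e_l)U_k(z)⁻¹`:
  -- the four terms are `R(b)⁻¹(R(u)⁻¹Y − R(v)⁻¹Y) + (R(a)⁻¹ − R(b)⁻¹)(R(u)⁻¹Y − Y)`
  have hF : R (U k ((T k).symm x))⁻¹ (R (U l z)⁻¹ (R (fluct η A l z)⁻¹ (Φ z))) - R (U k ((T k).symm x))⁻¹ (R (U l z)⁻¹ (Φ z))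
        - R (U l ((T l).symm x))⁻¹ (R (fluct η A l ((T l).symm x))⁻¹ (R (U k z)⁻¹ (Φ z))) + R (U l ((T l).symm x))⁻¹ (R (U k z)⁻¹ (Φ z))
      = R (U k z * U l ((T l).symm x))⁻¹ (R (fluct η A l z)⁻¹ (Φ z) - R (U k z * fluct η A l ((T l).symm x) * (U k z)⁻¹)⁻¹ (Φ z))
        + (R (U l z * U k ((T k).symm x))⁻¹ (R (fluct η A l z)⁻¹ (Φ z) - Φ z)
            - R (U k z * U l ((T l).symm x))⁻¹ (R (fluct η A l z)⁻¹ (Φ z) - Φ z)) := by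
    have h1 : R (U l ((T l).symm x))⁻¹ (R (fluct η A l ((T l).symm x))⁻¹ (R (U k z)⁻¹ (Φ z)))
        = R (U k z * U l ((T l).symm x))⁻¹ (R (U k z * fluct η A l ((T l).symm x) * (U k z)⁻¹)⁻¹ (Φ z)) := by
      rw [← B9Eq39Adjoint.R_mul, ← B9Eq39Adjoint.R_mul, ← B9Eq39Adjoint.R_mul]
      congr 1
      group
    rw [h1, mul_inv_rev (U l z)]
    simp only [B9Eq39Adjoint.R_mul, R_sub]
    have h2 : R (U l ((T l).symm x))⁻¹ (R (U k z)⁻¹ (Φ z)) = R (U k z * U l ((T l).symm x))⁻¹ (Φ z) := by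
      rw [mul_inv_rev, B9Eq39Adjoint.R_mul]
    rw [h2]
    abel
  rw [hF]
  generalize hY : Φ z = Y
  set a : 𝔸ˣ := U l z * U k ((T k).symm x) with ha
  set bU : 𝔸ˣ := U k z * U l ((T l).symm x) with hbU
  set u : 𝔸ˣ := fluct η A l z with hu
  set v : 𝔸ˣ := U k z * fluct η A l ((T l).symm x) * (U k z)⁻¹ with hv
  set ℓz : ℝ := g.len (blk z) with hℓz
  -- the exponents
  set X : 𝔸 := ((I * η : ℂ)) • A l z with hX
  set X' : 𝔸 := ((I * η : ℂ)) • A l ((T l).symm x) with hX'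
  set P : 𝔸 := ((U k z : 𝔸ˣ) : 𝔸) * X' * (((U k z)⁻¹ : 𝔸ˣ) : 𝔸) with hP
  have hXn : ‖X‖ ≤ 1 / 4 := by
    rw [hX, norm_Iη_smul hη.le]
    exact (mul_le_mul_of_nonneg_left (hA1 l z) hη.le).trans (hsmall _)
  have hX'n : ‖X'‖ ≤ 1 / 4 := by
    rw [hX', norm_Iη_smul hη.le]
    exact (mul_le_mul_of_nonneg_left (hA1 l ((T l).symm x)) hη.le).trans (hsmall _)
  have hPn : ‖P‖ ≤ 1 / 4 := by
    calc ‖P‖ ≤ ‖((U k z : 𝔸ˣ) : 𝔸)‖ * ‖X'‖ * ‖(((U k z)⁻¹ : 𝔸ˣ) : 𝔸)‖ :=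
          (norm_mul_le _ _).trans (mul_le_mul_of_nonneg_right (norm_mul_le _ _) (norm_nonneg _))
      _ ≤ 1 * ‖X'‖ * 1 := by
          gcongr
          · exact (hρu k z).1
          · exact (hρu k z).2
      _ ≤ 1 / 4 := by rw [one_mul, mul_one]; exact hX'n
  have hu_val : (u : 𝔸) = exp X := by rw [hu, val_fluct]
  have hu_inv : ((u⁻¹ : 𝔸ˣ) : 𝔸) = exp (-X) := by rw [hu, val_inv_fluct]
  have hv_val : (v : 𝔸) = exp P := by
    rw [hv, Units.val_mul, Units.val_mul, val_fluct, hP, B12Membership314.exp_units_conj']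
  have hv_inv : ((v⁻¹ : 𝔸ˣ) : 𝔸) = exp (-P) := by
    rw [hv, mul_inv_rev, mul_inv_rev, inv_inv, Units.val_mul, Units.val_mul, val_inv_fluct, hP, ← mul_assoc,
      B12Membership314.exp_neg_units_conj']
  -- for the inverse transports the roles of `u, v` and `u⁻¹, v⁻¹` are exchanged (`R(u)⁻¹ = R(u⁻¹)`)
  have hun : ‖(u : 𝔸)‖ ≤ 2 := by
    rw [hu_val]; exact (Literature.Analysis.Complex.norm_exp_le_exp_norm X).trans ((Real.exp_le_exp.2 hXn).trans he4)
  have hvn : ‖(v : 𝔸)‖ ≤ Real.exp (1 / 4) := by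
    rw [hv_val]; exact (Literature.Analysis.Complex.norm_exp_le_exp_norm P).trans (Real.exp_le_exp.2 hPn)
  have hvin : ‖((v⁻¹ : 𝔸ˣ) : 𝔸)‖ ≤ Real.exp (1 / 4) := by
    rw [hv_inv]
    exact (Literature.Analysis.Complex.norm_exp_le_exp_norm (-P)).trans (Real.exp_le_exp.2 (by rw [norm_neg]; exact hPn))
  have hvv : ‖((v⁻¹ : 𝔸ˣ) : 𝔸)‖ * ‖(v : 𝔸)‖ ≤ 2 := by
    refine (mul_le_mul hvin hvn (norm_nonneg _) (Real.exp_pos _).le).trans ?_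
    rw [← Real.exp_add]; norm_num; exact he2
  -- `P − X = iη·∇_{U,k}A_l(z)` (`z + e_k = x − e_l`)
  have hPX : P - X = ((I * η : ℂ)) • covD T U k (A l) z := by
    rw [covD, hk, smul_sub, ← R_smul, hP, hX', R_def]
  have hcov : ‖covD T U k (A l) z‖ ≤ η * (α₁ * ℓz⁻¹ ^ 2) := norm_le_of_norm_inv_smul_le hη hA2
  have hvu : ‖((u⁻¹ : 𝔸ˣ) : 𝔸) - ((v⁻¹ : 𝔸ˣ) : 𝔸)‖ ≤ η * (η * (α₁ * ℓz⁻¹ ^ 2)) * 2 := by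
    rw [hv_inv, hu_inv]
    refine (Literature.Analysis.Complex.norm_exp_sub_exp_le (-X) (-P)).trans ?_
    rw [show -X - -P = P - X by abel, hPX, norm_Iη_smul hη.le, norm_neg, norm_neg]
    exact mul_le_mul (mul_le_mul_of_nonneg_left hcov hη.le) ((Real.exp_le_exp.2 (max_le hXn hPn)).trans he4) (Real.exp_pos _).le
      (by positivity)
  -- unit-norm transports
  have ha1 : ‖((a : 𝔸ˣ) : 𝔸)‖ ≤ 1 ∧ ‖((a⁻¹ : 𝔸ˣ) : 𝔸)‖ ≤ 1 := by
    refine ⟨?_, ?_⟩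
    · rw [ha, Units.val_mul]; exact (norm_mul_le _ _).trans (mul_le_one₀ (hρu l z).1 (norm_nonneg _) (hρu k _).1)
    · rw [ha, mul_inv_rev, Units.val_mul]; exact (norm_mul_le _ _).trans (mul_le_one₀ (hρu k _).2 (norm_nonneg _) (hρu l z).2)
  have hb1 : ‖((bU : 𝔸ˣ) : 𝔸)‖ ≤ 1 ∧ ‖((bU⁻¹ : 𝔸ˣ) : 𝔸)‖ ≤ 1 := by
    refine ⟨?_, ?_⟩
    · rw [hbU, Units.val_mul]; exact (norm_mul_le _ _).trans (mul_le_one₀ (hρu k z).1 (norm_nonneg _) (hρu l _).1)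
    · rw [hbU, mul_inv_rev, Units.val_mul]; exact (norm_mul_le _ _).trans (mul_le_one₀ (hρu l _).2 (norm_nonneg _) (hρu k z).2)
  have hRinv1 : ∀ (w : 𝔸ˣ) (W : 𝔸), ‖((w : 𝔸ˣ) : 𝔸)‖ ≤ 1 ∧ ‖((w⁻¹ : 𝔸ˣ) : 𝔸)‖ ≤ 1 → ‖R w⁻¹ W‖ ≤ ‖W‖ := by
    intro w W hw
    have := B9Eq371Composition.norm_R_le_sq w⁻¹ hw.2 (by rw [inv_inv]; exact hw.1) W
    rwa [one_pow, one_mul] at this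
  -- (i) the Leibniz defect term, transported by `R(b)⁻¹`
  have hi : ‖R bU⁻¹ (R u⁻¹ Y - R v⁻¹ Y)‖ ≤ (η * η) * (12 * (α₁ * ℓz⁻¹ ^ 2) * ‖Y‖) := by
    refine (hRinv1 bU _ hb1).trans ((norm_R_sub_R_le' u⁻¹ v⁻¹ Y).trans ?_)
    rw [inv_inv, inv_inv]
    have h5 : ‖(u : 𝔸)‖ * (1 + ‖((v⁻¹ : 𝔸ˣ) : 𝔸)‖ * ‖(v : 𝔸)‖) ≤ 2 * (1 + 2) :=
      mul_le_mul hun (by linarith) (by positivity) (by norm_num)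
    calc ‖(u : 𝔸)‖ * (1 + ‖((v⁻¹ : 𝔸ˣ) : 𝔸)‖ * ‖(v : 𝔸)‖) * ‖((u⁻¹ : 𝔸ˣ) : 𝔸) - ((v⁻¹ : 𝔸ˣ) : 𝔸)‖ * ‖Y‖
        ≤ (2 * (1 + 2)) * (η * (η * (α₁ * ℓz⁻¹ ^ 2)) * 2) * ‖Y‖ :=
          mul_le_mul_of_nonneg_right (mul_le_mul h5 hvu (norm_nonneg _) (by positivity)) (norm_nonneg _)
      _ = _ := by ring
  -- (ii) the shift-commutator term: `(R(a)⁻¹ − R(b)⁻¹)W = R(a⁻¹)(R(b)Q − R(a)Q)`, `Q = R(b⁻¹)W`, `W = R(u)⁻¹Y − Y`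
  have hii : ‖R a⁻¹ (R u⁻¹ Y - Y) - R bU⁻¹ (R u⁻¹ Y - Y)‖ ≤ (η * η) * (4 * cP * (η * ℓz⁻¹) * (α₁ * ℓz⁻¹ ^ 2) * ‖Y‖) := by
    rw [R_inv_sub_R_inv]
    refine (hRinv1 a _ ha1).trans ?_
    have hQ : ‖R bU⁻¹ (R u⁻¹ Y - Y)‖ ≤ ‖R u⁻¹ Y - Y‖ := hRinv1 bU _ hb1
    have hW : ‖R u⁻¹ Y - Y‖ ≤ (4 * (η * (α₁ * ℓz⁻¹))) * ‖Y‖ := by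
      have hc : R u⁻¹ Y - Y = exp (-X) * Y * exp (-(-X)) - Y := by rw [R_def, inv_inv, hu_inv, hu_val, neg_neg]
      rw [hc]
      refine (norm_conj_sub_le (-X) Y).trans (mul_le_mul_of_nonneg_right ?_ (norm_nonneg _))
      rw [norm_neg]
      refine (exp_two_mul_sub_one_le (norm_nonneg _) hXn).trans ?_
      rw [hX, norm_Iη_smul hη.le]
      exact mul_le_mul_of_nonneg_left (mul_le_mul_of_nonneg_left (hA1 l z) hη.le) (by norm_num)
    have hp := hplaq (R bU⁻¹ (R u⁻¹ Y - Y))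
    calc ‖R bU (R bU⁻¹ (R u⁻¹ Y - Y)) - R a (R bU⁻¹ (R u⁻¹ Y - Y))‖
        ≤ cP * (η * ℓz⁻¹) ^ 2 * ‖R bU⁻¹ (R u⁻¹ Y - Y)‖ := hp
      _ ≤ cP * (η * ℓz⁻¹) ^ 2 * ((4 * (η * (α₁ * ℓz⁻¹))) * ‖Y‖) := mul_le_mul_of_nonneg_left (hQ.trans hW) (by positivity)
      _ = _ := by ring
  -- assembling with `‖c²‖ = η⁻²`
  rw [norm_smul, norm_mul, norm_inv, Complex.norm_real, Real.norm_eq_abs, abs_of_pos hη]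
  have hη2 : η⁻¹ * η⁻¹ * (η * η) = 1 := by
    rw [← mul_inv, inv_mul_cancel₀ (mul_ne_zero hη.ne' hη.ne')]
  have hsum := (norm_add_le (R bU⁻¹ (R u⁻¹ Y - R v⁻¹ Y)) (R a⁻¹ (R u⁻¹ Y - Y) - R bU⁻¹ (R u⁻¹ Y - Y))).trans (add_le_add hi hii)
  have hY0 : 0 ≤ α₁ * ℓz⁻¹ ^ 2 * ‖Y‖ := by positivity
  calc η⁻¹ * η⁻¹ * ‖R bU⁻¹ (R u⁻¹ Y - R v⁻¹ Y) + (R a⁻¹ (R u⁻¹ Y - Y) - R bU⁻¹ (R u⁻¹ Y - Y))‖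
      ≤ η⁻¹ * η⁻¹ * ((η * η) * (12 * (α₁ * ℓz⁻¹ ^ 2) * ‖Y‖) + (η * η) * (4 * cP * (η * ℓz⁻¹) * (α₁ * ℓz⁻¹ ^ 2) * ‖Y‖)) :=
        mul_le_mul_of_nonneg_left hsum (by positivity)
    _ = 12 * (α₁ * ℓz⁻¹ ^ 2 * ‖Y‖) + 4 * cP * (η * ℓz⁻¹) * (α₁ * ℓz⁻¹ ^ 2 * ‖Y‖) := by
        rw [← mul_add, ← mul_assoc, hη2, one_mul]; ring
    _ ≤ 12 * (α₁ * ℓz⁻¹ ^ 2 * ‖Y‖) + 4 * cP * 1 * (α₁ * ℓz⁻¹ ^ 2 * ‖Y‖) := by gcongr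
    _ = (12 + 4 * cP) * α₁ * ℓz⁻¹ ^ 2 * ‖Y‖ := by ring

end Pointwise

/-! ## §2  The two commutators are block-`ℓ²` letters of weight `α₁ℓ⁻²` ([4] (2.140), multiplicity one) -/

section Letters

variable {𝔸 : Type*} [NormedRing 𝔸] [NormedAlgebra ℂ 𝔸] [CompleteSpace 𝔸] [NormOneClass 𝔸] {ι : Type} [Fintype ι] [DecidableEq ι]
variable (b : Module.Basis ι ℝ 𝔸) {S : Type} [Fintype S] [DecidableEq S] {κ : Type}
variable (T : κ → Equiv.Perm S) (U : κ → S → 𝔸ˣ)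
variable {g : B9.Geometry} [Fintype g.Site] {Rr : ℝ} {H : Prop}

omit [Fintype S] [DecidableEq S] in
/-- commuting shifts, read backwards: `(x − e_l) − e_k = (x − e_k) − e_l`, `((x − e_k) − e_l) + e_k = x − e_l`, `((x − e_k) − e_l) + e_l = x − e_k` (the lattice
`T_η` of p. 390). [cite: Balaban1985BackgroundPropagators, (3.3) p.390, bookkeeping] -/
theorem symm_comm_of_comm {k l : κ} (hcomm : ∀ x, T k (T l x) = T l (T k x)) (x : S) :
    (T k).symm ((T l).symm x) = (T l).symm ((T k).symm x) ∧ T k ((T l).symm ((T k).symm x)) = (T l).symm x ∧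
      T l ((T l).symm ((T k).symm x)) = (T k).symm x := by
  have h3 : T l ((T l).symm ((T k).symm x)) = (T k).symm x := Equiv.apply_symm_apply _ _
  have h2 : T k ((T l).symm ((T k).symm x)) = (T l).symm x := by
    apply (T l).injective
    rw [← hcomm, h3, Equiv.apply_symm_apply, Equiv.apply_symm_apply]
  refine ⟨?_, h2, h3⟩
  rw [Equiv.symm_apply_eq, Equiv.symm_apply_eq, h2, Equiv.apply_symm_apply]

omit [CompleteSpace 𝔸] [NormOneClass 𝔸] in
/-- a one-neighbour local letter with a blockwise size `c(y(x))·‖Ψ(nb x)‖` (`c ≧ 0`, `nb` injective, stencil `d(y(x), y(nb x)) ≦ d₁`) is a block-`ℓ²` letter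
`≺₂ c(y)·M₂(Σ‖b_i‖)√|ι|·e^{δd₁}·e^{−δd}` ([4] (2.140), multiplicity one). [cite: Balaban1984PropagatorsII, Prop. 2.6 (2.140) p.247, (2.51) p.232] -/
theorem hasL2Majorant_conj_of_oneNeighbour_w (blk : S → g.Site) (nb : S → S) (hinj : Function.Injective nb) (c : g.Site → ℝ) (d₁ δ M₂ : ℝ)
    (hc : ∀ y, 0 ≤ c y) (hδ : 0 ≤ δ) (hM₂ : 0 ≤ M₂) (hrepr : ∀ (v : 𝔸) (i : ι), |b.repr v i| ≤ M₂ * ‖v‖)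
    (hd₁ : ∀ x, g.dist (blk x) (blk (nb x)) ≤ d₁) (L : Module.End ℝ (S → 𝔸)) (hL : ∀ (f : S → 𝔸) (x : S), ‖L f x‖ ≤ c (blk x) * ‖f (nb x)‖) :
    HasL2Majorant (g := toB6 g Rr H) (fun p : S × ι => blk p.1) (conj b L)
      (fun y y' => (c y * M₂ * (∑ i, ‖b i‖) * Real.sqrt (Fintype.card ι) * Real.exp (δ * d₁)) * Real.exp (-(δ * g.dist y y'))) := by
  let near : S → S → Prop := fun x x' => x' = nb x
  have hnear : ∀ x x', near x x' → g.dist (blk x) (blk x') ≤ d₁ := by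
    intro x x' hx'; simp only [near] at hx'; rw [hx']; exact hd₁ x
  have hmult : ∀ x' : S, ∃ s : Finset S, (s.card : ℝ) ≤ (1 : ℕ) ∧ ∀ x, near x x' → x ∈ s := by
    classical
    intro x'
    refine ⟨Finset.univ.filter (fun x => nb x = x'), ?_, fun x hx => ?_⟩
    · have hle : (Finset.univ.filter (fun x => nb x = x')).card ≤ 1 := by
        refine Finset.card_le_one.2 fun x hx y hy => ?_
        rw [Finset.mem_filter] at hx hy
        exact hinj (hx.2.trans hy.2.symm)
      exact_mod_cast hle
    · rw [Finset.mem_filter]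
      exact ⟨Finset.mem_univ _, Eq.symm hx⟩
  refine hasL2Majorant_mono (g := toB6 g Rr H) _
    (hasL2Majorant_conj_of_local (Rr := Rr) (H := H) b blk near c d₁ δ M₂ 1 hc hδ hM₂ hrepr hnear hmult L ?_) fun y y' => le_of_eq ?_
  · intro f x B hB
    exact (hL f x).trans (mul_le_mul_of_nonneg_left (hB _ rfl) (hc _))
  · have h1 : Real.sqrt ((1 * Fintype.card ι : ℕ) : ℝ) = Real.sqrt (Fintype.card ι) := by rw [one_mul]
    rw [h1]; ring

/-- ★ **THE FORWARD COMMUTATOR IS A BLOCK-`ℓ²` LETTER OF WEIGHT `α₁ℓ⁻²`**: under the hypotheses of `norm_comm_diffLetter_defect_apply_inl_le` at every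
point (commuting shifts, unit transports, (3.37) blockwise with its second clause, `ηα₁ℓ⁻¹ ≦ 1/4`, `η ≦ ℓ`, the plaquette smallness `c_P`), the one-step
stencil bound `d₀` and the triangle inequality:
`conj b [∇♯_{U,k}, ∇♯_{U′U,l} − ∇♯_{U,l}] ≺₂ (12 + 4c_P)·α₁ℓ(y)⁻²·M₂(Σ‖b_i‖)√|ι|·e^{2δd₀}·e^{−δd(y,y′)}` for every `δ ≧ 0`.
[cite: Balaban1985BackgroundPropagators, p.403 l.1–9, (3.70) p.404, (3.37) p.396; Balaban1984PropagatorsII, Prop. 2.6 (2.140) p.247] -/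
theorem hasL2Majorant_comm_inl (blk : S → g.Site) {η : ℝ} (hη : 0 < η) (A : κ → S → 𝔸) {α₁ cP : ℝ} (d₀ δ M₂ : ℝ)
    (hα₁ : 0 ≤ α₁) (hcP : 0 ≤ cP) (hδ : 0 ≤ δ) (hM₂ : 0 ≤ M₂) (hrepr : ∀ (v : 𝔸) (i : ι), |b.repr v i| ≤ M₂ * ‖v‖) (k l : κ)
    (hcomm : ∀ x, T k (T l x) = T l (T k x))
    (hρu : ∀ μ y, ‖((U μ y : 𝔸ˣ) : 𝔸)‖ ≤ 1 ∧ ‖(((U μ y)⁻¹ : 𝔸ˣ) : 𝔸)‖ ≤ 1)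
    (hsmall : ∀ y : g.Site, η * (α₁ * (g.len y)⁻¹) ≤ 1 / 4) (hlen : ∀ y : g.Site, 0 < g.len y)
    (hA1 : ∀ μ y, ‖A μ y‖ ≤ α₁ * (g.len (blk y))⁻¹)
    (hA2 : ∀ x, ‖((η : ℂ))⁻¹ • covD T U k (A l) x‖ ≤ α₁ * (g.len (blk x) ^ 2)⁻¹)
    (hplaq : ∀ (x : S) (X : 𝔸), ‖R (U k x * U l (T k x)) X - R (U l x * U k (T l x)) X‖ ≤ cP * (η * (g.len (blk x))⁻¹) ^ 2 * ‖X‖)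
    (heta : ∀ y : g.Site, η ≤ g.len y) (htri : ∀ a b c : g.Site, g.dist a c ≤ g.dist a b + g.dist b c)
    (hd₀ : ∀ μ x, g.dist (blk x) (blk (T μ x)) ≤ d₀ ∧ g.dist (blk x) (blk ((T μ).symm x)) ≤ d₀) :
    HasL2Majorant (g := toB6 g Rr H) (fun p : S × ι => blk p.1)
      (conj b (diffLetter T U (((η : ℂ))⁻¹) (Sum.inl k)
          * (diffLetter T (prodCfg U η A) (((η : ℂ))⁻¹) (Sum.inl l) - diffLetter T U (((η : ℂ))⁻¹) (Sum.inl l))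
        - (diffLetter T (prodCfg U η A) (((η : ℂ))⁻¹) (Sum.inl l) - diffLetter T U (((η : ℂ))⁻¹) (Sum.inl l))
          * diffLetter T U (((η : ℂ))⁻¹) (Sum.inl k)))
      (fun y y' => ((12 + 4 * cP) * (α₁ * (g.len y)⁻¹ ^ 2) * M₂ * (∑ i, ‖b i‖) * Real.sqrt (Fintype.card ι) * Real.exp (δ * (2 * d₀)))
        * Real.exp (-(δ * g.dist y y'))) := by
  refine hasL2Majorant_conj_of_oneNeighbour_w b (Rr := Rr) (H := H) blk (fun x => T k (T l x)) ?_ (fun y => (12 + 4 * cP) * (α₁ * (g.len y)⁻¹ ^ 2))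
    (2 * d₀) δ M₂ (fun y => ?_) hδ hM₂ hrepr (fun x => ?_) _ (fun f x => ?_)
  · exact fun x x' h => (T l).injective ((T k).injective h)
  · have := hlen y; positivity
  · calc g.dist (blk x) (blk (T k (T l x))) ≤ g.dist (blk x) (blk (T l x)) + g.dist (blk (T l x)) (blk (T k (T l x))) := htri _ _ _
      _ ≤ d₀ + d₀ := add_le_add (hd₀ l x).1 (hd₀ k (T l x)).1
      _ = 2 * d₀ := by ring
  · have h := norm_comm_diffLetter_defect_apply_inl_le T U blk hη A hα₁ hcP k l x ((hcomm x).symm) hρu hsmall hlen hA1 (hA2 x) (hplaq x)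
      (heta _) f
    calc _ ≤ _ := h
      _ = _ := by ring

/-- ★ **THE BACKWARD COMMUTATOR IS A BLOCK-`ℓ²` LETTER OF WEIGHT `α₁ℓ⁻²`**: as `hasL2Majorant_comm_inl`, with the sizes read at the far point
`z = x − e_k − e_l` and brought to the output block by a scale comparability `ℓ(y(z))⁻² ≦ σ₂·ℓ(y(x))⁻²` (two steps; `σ₂ ≧ 0`):
`conj b [∇♯_{U,inr k}, ∇♯_{U′U,inr l} − ∇♯_{U,inr l}] ≺₂ (12 + 4c_P)σ₂·α₁ℓ(y)⁻²·M₂(Σ‖b_i‖)√|ι|·e^{2δd₀}·e^{−δd(y,y′)}`.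
[cite: Balaban1985BackgroundPropagators, p.403 l.1–9, (3.74) p.405, (3.37) p.396; Balaban1984PropagatorsII, Prop. 2.6 (2.140) p.247] -/
theorem hasL2Majorant_comm_inr (blk : S → g.Site) {η : ℝ} (hη : 0 < η) (A : κ → S → 𝔸) {α₁ cP σ₂ : ℝ} (d₀ δ M₂ : ℝ)
    (hα₁ : 0 ≤ α₁) (hcP : 0 ≤ cP) (hσ₂ : 0 ≤ σ₂) (hδ : 0 ≤ δ) (hM₂ : 0 ≤ M₂) (hrepr : ∀ (v : 𝔸) (i : ι), |b.repr v i| ≤ M₂ * ‖v‖) (k l : κ)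
    (hcomm : ∀ x, T k (T l x) = T l (T k x))
    (hρu : ∀ μ y, ‖((U μ y : 𝔸ˣ) : 𝔸)‖ ≤ 1 ∧ ‖(((U μ y)⁻¹ : 𝔸ˣ) : 𝔸)‖ ≤ 1)
    (hsmall : ∀ y : g.Site, η * (α₁ * (g.len y)⁻¹) ≤ 1 / 4) (hlen : ∀ y : g.Site, 0 < g.len y)
    (hA1 : ∀ μ y, ‖A μ y‖ ≤ α₁ * (g.len (blk y))⁻¹)
    (hA2 : ∀ x, ‖((η : ℂ))⁻¹ • covD T U k (A l) x‖ ≤ α₁ * (g.len (blk x) ^ 2)⁻¹)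
    (hplaq : ∀ (x : S) (X : 𝔸), ‖R (U k x * U l (T k x)) X - R (U l x * U k (T l x)) X‖ ≤ cP * (η * (g.len (blk x))⁻¹) ^ 2 * ‖X‖)
    (heta : ∀ y : g.Site, η ≤ g.len y) (htri : ∀ a b c : g.Site, g.dist a c ≤ g.dist a b + g.dist b c)
    (hd₀ : ∀ μ x, g.dist (blk x) (blk (T μ x)) ≤ d₀ ∧ g.dist (blk x) (blk ((T μ).symm x)) ≤ d₀)
    (hσ : ∀ x, (g.len (blk ((T l).symm ((T k).symm x))))⁻¹ ^ 2 ≤ σ₂ * (g.len (blk x))⁻¹ ^ 2) :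
    HasL2Majorant (g := toB6 g Rr H) (fun p : S × ι => blk p.1)
      (conj b (diffLetter T U (((η : ℂ))⁻¹) (Sum.inr k)
          * (diffLetter T (prodCfg U η A) (((η : ℂ))⁻¹) (Sum.inr l) - diffLetter T U (((η : ℂ))⁻¹) (Sum.inr l))
        - (diffLetter T (prodCfg U η A) (((η : ℂ))⁻¹) (Sum.inr l) - diffLetter T U (((η : ℂ))⁻¹) (Sum.inr l))
          * diffLetter T U (((η : ℂ))⁻¹) (Sum.inr k)))
      (fun y y' => ((12 + 4 * cP) * σ₂ * (α₁ * (g.len y)⁻¹ ^ 2) * M₂ * (∑ i, ‖b i‖) * Real.sqrt (Fintype.card ι) * Real.exp (δ * (2 * d₀)))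
        * Real.exp (-(δ * g.dist y y'))) := by
  refine hasL2Majorant_conj_of_oneNeighbour_w b (Rr := Rr) (H := H) blk (fun x => (T l).symm ((T k).symm x)) ?_
    (fun y => (12 + 4 * cP) * σ₂ * (α₁ * (g.len y)⁻¹ ^ 2)) (2 * d₀) δ M₂ (fun y => ?_) hδ hM₂ hrepr (fun x => ?_) _ (fun f x => ?_)
  · exact fun x x' h => (T k).symm.injective ((T l).symm.injective h)
  · have := hlen y; positivity
  · calc g.dist (blk x) (blk ((T l).symm ((T k).symm x)))
        ≤ g.dist (blk x) (blk ((T k).symm x)) + g.dist (blk ((T k).symm x)) (blk ((T l).symm ((T k).symm x))) := htri _ _ _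
      _ ≤ d₀ + d₀ := add_le_add (hd₀ k x).2 (hd₀ l ((T k).symm x)).2
      _ = 2 * d₀ := by ring
  · obtain ⟨h1, h2, h3⟩ := symm_comm_of_comm T hcomm x
    have hp : ∀ X : 𝔸, ‖R (U k ((T l).symm ((T k).symm x)) * U l (T k ((T l).symm ((T k).symm x)))) X
        - R (U l ((T l).symm ((T k).symm x)) * U k (T l ((T l).symm ((T k).symm x)))) X‖
        ≤ cP * (η * (g.len (blk ((T l).symm ((T k).symm x))))⁻¹) ^ 2 * ‖X‖ := fun X => hplaq _ X
    have h := norm_comm_diffLetter_defect_apply_inr_le T U blk hη A hα₁ hcP k l x h1 h2 h3 hρu hsmall hlen hA1 (hA2 _) hp (heta _) f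
    refine h.trans ?_
    have h0 : 0 ≤ (12 + 4 * cP) * α₁ * ‖f ((T l).symm ((T k).symm x))‖ := by positivity
    calc (12 + 4 * cP) * α₁ * (g.len (blk ((T l).symm ((T k).symm x))))⁻¹ ^ 2 * ‖f ((T l).symm ((T k).symm x))‖
        = (g.len (blk ((T l).symm ((T k).symm x))))⁻¹ ^ 2 * ((12 + 4 * cP) * α₁ * ‖f ((T l).symm ((T k).symm x))‖) := by ring
      _ ≤ σ₂ * (g.len (blk x))⁻¹ ^ 2 * ((12 + 4 * cP) * α₁ * ‖f ((T l).symm ((T k).symm x))‖) := mul_le_mul_of_nonneg_right (hσ x) h0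
      _ = _ := by ring

omit [Fintype g.Site] in
/-- the backward scale comparability from a scale transfer: if `e^{−αδ₀d(y,y′)}w(y′) ≦ Λw(y)` for all blocks and `d(y, y′) ≦ D`, then `w(y′) ≦ Λe^{αδ₀D}·w(y)`
(used with `w = ℓ⁻²`, `y = y(x)`, `y′ = y(x − e_k − e_l)`, `D = 2d₀`). [cite: Balaban1985BackgroundPropagators, (3.47) p.398, bookkeeping] -/
theorem le_of_scaleTransfer {δ₀ α Λ D : ℝ} {w : g.Site → ℝ} (hST : ScaleTransfer g δ₀ α Λ w) (hαδ : 0 ≤ α * δ₀) {y y' : g.Site}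
    (hd : g.dist y y' ≤ D) (hw : 0 ≤ w y') : w y' ≤ Λ * Real.exp (α * δ₀ * D) * w y := by
  have h := hST y y'
  have hexp : Real.exp (-(α * δ₀ * g.dist y y')) * Real.exp (α * δ₀ * D) ≥ 1 := by
    rw [← Real.exp_add]
    exact Real.one_le_exp (by nlinarith)
  have hpos : 0 < Real.exp (α * δ₀ * D) := Real.exp_pos _
  calc w y' ≤ Real.exp (-(α * δ₀ * g.dist y y')) * Real.exp (α * δ₀ * D) * w y' := le_mul_of_one_le_left hw hexp
    _ = Real.exp (-(α * δ₀ * g.dist y y')) * w y' * Real.exp (α * δ₀ * D) := by ring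
    _ ≤ Λ * w y * Real.exp (α * δ₀ * D) := mul_le_mul_of_nonneg_right h hpos.le
    _ = Λ * Real.exp (α * δ₀ * D) * w y := by ring

omit [Fintype S] [DecidableEq S] [Fintype g.Site] in
/-- the two-step backward scale comparability `ℓ(y(x−e_k−e_l))⁻² ≦ Λe^{2αδ₀d₀}·ℓ(y(x))⁻²` from the scale transfer of `ℓ⁻²`, the one-step stencil bound and
the triangle inequality. [cite: Balaban1985BackgroundPropagators, (3.47) p.398, bookkeeping] -/
theorem sigma_two_of_scaleTransfer (blk : S → g.Site) {δ₀ α Λ d₀ : ℝ} (hST : ScaleTransfer g δ₀ α Λ (fun a => (g.len a)⁻¹ ^ 2))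
    (hαδ : 0 ≤ α * δ₀) (hlen : ∀ y : g.Site, 0 < g.len y) (htri : ∀ a b c : g.Site, g.dist a c ≤ g.dist a b + g.dist b c)
    (hd₀ : ∀ μ x, g.dist (blk x) (blk (T μ x)) ≤ d₀ ∧ g.dist (blk x) (blk ((T μ).symm x)) ≤ d₀) (μ ν : κ) (x : S) :
    (g.len (blk ((T ν).symm ((T μ).symm x))))⁻¹ ^ 2 ≤ (Λ * Real.exp (α * δ₀ * (2 * d₀))) * (g.len (blk x))⁻¹ ^ 2 := by
  have hd : g.dist (blk x) (blk ((T ν).symm ((T μ).symm x))) ≤ 2 * d₀ :=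
    calc g.dist (blk x) (blk ((T ν).symm ((T μ).symm x)))
        ≤ g.dist (blk x) (blk ((T μ).symm x)) + g.dist (blk ((T μ).symm x)) (blk ((T ν).symm ((T μ).symm x))) := htri _ _ _
      _ ≤ d₀ + d₀ := add_le_add (hd₀ μ x).2 (hd₀ ν ((T μ).symm x)).2
      _ = 2 * d₀ := by ring
  exact le_of_scaleTransfer (w := fun a => (g.len a)⁻¹ ^ 2) hST hαδ hd (pow_nonneg (inv_nonneg.mpr (hlen _).le) _)

end Letters

/-! ## §3  ★★ The LEFT and RIGHT second-order conversions composed with the (3.46) entries of `Gp` -/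

section LeftRight

variable {𝔸 : Type*} [NormedRing 𝔸] [NormedAlgebra ℂ 𝔸] [CompleteSpace 𝔸] [NormOneClass 𝔸] {ι : Type} [Fintype ι] [DecidableEq ι]
variable (b : Module.Basis ι ℝ 𝔸) {S : Type} [Fintype S] [DecidableEq S] {κ : Type}
variable (T : κ → Equiv.Perm S) (U : κ → S → 𝔸ˣ)
variable {g : B9.Geometry} [Fintype g.Site] {Rr : ℝ} {H : Prop}

/-- the first-order defect constant of `B9Eq370LetterConversionL2` at unit transports, `c_E(r) = 4·M₂(Σ‖b_i‖)√|ι|·e^{r d₀}`.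
[cite: Balaban1985BackgroundPropagators, (3.70) p.404, bookkeeping] -/
def cE (M₂ Sb sι r d₀ : ℝ) : ℝ := 4 * M₂ * Sb * sι * Real.exp (r * d₀)

/-- the commutator constant, `c_Q(r) = (12 + 4c_P)·M₂(Σ‖b_i‖)√|ι|·e^{2 r d₀}`. [cite: Balaban1985BackgroundPropagators, p.403 l.1–9, bookkeeping] -/
def cQ (cP M₂ Sb sι r d₀ : ℝ) : ℝ := (12 + 4 * cP) * M₂ * Sb * sι * Real.exp (r * (2 * d₀))

/-- ★ the constant of the LEFT second-order conversion («of course with different constants», p. 403):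
`K_L = 1 + c₁α₁·(c_E(ρ₁)Λ₁ + c_Q(ρ₁)Λ₂ + c_E(ρ₁)Λ₁·(1 + c_E(δ)α₁Λ₂c₁))`. [cite: Balaban1985BackgroundPropagators, p.403 l.1–9, bookkeeping] -/
def conv2ConstL (cP M₂ Sb sι d₀ δ ρ₁ α₁ Λ₁ Λ₂ c1 : ℝ) : ℝ :=
  1 + c1 * α₁ * (cE M₂ Sb sι ρ₁ d₀ * Λ₁ + cQ cP M₂ Sb sι ρ₁ d₀ * Λ₂ + cE M₂ Sb sι ρ₁ d₀ * Λ₁ * (1 + cE M₂ Sb sι δ d₀ * α₁ * Λ₂ * c1))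

/-- ★ the constant of the RIGHT second-order conversion (with the backward scale comparability `σ₂`):
`K_R = 1 + c₁α₁·(c_E(ρ)Λ′₁ + σ₂c_Q(ρ)Λ′₂ + c_E(ρ)Λ′₁·(1 + c_E(ρ₁)α₁Λ′₁c₁))`. [cite: Balaban1985BackgroundPropagators, p.403 l.1–9, bookkeeping] -/
def conv2ConstR (cP σ₂ M₂ Sb sι d₀ ρ₁ ρ α₁ Λ₁ Λ₂ c1 : ℝ) : ℝ :=
  1 + c1 * α₁ * (cE M₂ Sb sι ρ d₀ * Λ₁ + σ₂ * cQ cP M₂ Sb sι ρ d₀ * Λ₂ + cE M₂ Sb sι ρ d₀ * Λ₁ * (1 + cE M₂ Sb sι ρ₁ d₀ * α₁ * Λ₁ * c1))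

/-- `c_E ≧ 0`. [cite: Balaban1985BackgroundPropagators, p.403 l.1–9, bookkeeping] -/
theorem cE_nonneg {M₂ Sb sι : ℝ} (hM₂ : 0 ≤ M₂) (hSb : 0 ≤ Sb) (hsι : 0 ≤ sι) (r d₀ : ℝ) : 0 ≤ cE M₂ Sb sι r d₀ := by
  unfold cE; positivity

/-- `c_Q ≧ 0` (`c_P ≧ 0`). [cite: Balaban1985BackgroundPropagators, p.403 l.1–9, bookkeeping] -/
theorem cQ_nonneg {cP M₂ Sb sι : ℝ} (hcP : 0 ≤ cP) (hM₂ : 0 ≤ M₂) (hSb : 0 ≤ Sb) (hsι : 0 ≤ sι) (r d₀ : ℝ) : 0 ≤ cQ cP M₂ Sb sι r d₀ := by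
  unfold cQ; positivity

/-- ★★ **THE LEFT SECOND-ORDER CONVERSION IN `L²`, `∇♯_{U,k}∇♯_{U,l}·Gp ↦ ∇♯_{U′U,k}∇♯_{U′U,l}·Gp`** (forward letters, p. 403 l.1–9 with (3.70); the (3.46)
member `∇_U∇_U G′`).  If `Gp ≺₂ Bℓ²e^{−δd}`, `∇♯_k·Gp, ∇♯_l·Gp ≺₂ Bℓe^{−δd}` and `∇♯_k∇♯_l·Gp ≺₂ B·e^{−δd}` (letters at `U`), then under (3.37) blockwise with its
second clause, unit transports, `ηα₁ℓ⁻¹ ≦ 1/4`, `η ≦ ℓ`, commuting shifts, the plaquette smallness `c_P` of the base, the stencil geometry, the scale transfers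
of `ℓ` (`Λ₁`) and `ℓ²` (`Λ₂`) at exponent `α` and (2.61) at `β`, for rates `ρ ≦ ρ₁ ≦ δ` with `ρ₁ + (α+β)δ₀ ≦ δ`, `ρ + (α+β)δ₀ ≦ ρ₁` (two composition steps):
`∇♯_{U′U,k}∇♯_{U′U,l}·Gp ≺₂ K_L·B·e^{−ρd}` — from `∇^W_k∇^W_l = ∇_k∇_l + E_l∇_k + [∇_k, E_l] + E_k∇^W_l` and [4] (2.141) for each product.
[cite: Balaban1985BackgroundPropagators, p.403 l.1–9, (3.70) p.404, (3.46) p.398, (3.37) p.396; Balaban1984PropagatorsII, Prop. 2.6 (2.140)–(2.141) p.247, Lemma 2.1 p.234] -/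
theorem hasL2Majorant_diffLetter2_prodCfg_mul (blk : S → g.Site) (d : ℕ) {η : ℝ} (hη : 0 < η) (A : κ → S → 𝔸)
    (d₀ M₂ α₁ cP δ₀ δ α β ρ₁ ρ Λ₁ Λ₂ B : ℝ)
    (hα₁ : 0 ≤ α₁) (hcP : 0 ≤ cP) (hM₂ : 0 ≤ M₂) (hB : 0 ≤ B) (hΛ₁ : 0 ≤ Λ₁) (hΛ₂ : 0 ≤ Λ₂) (hρ : 0 ≤ ρ) (hρ₁ : 0 ≤ ρ₁)
    (hr₁ : ρ₁ + (α + β) * δ₀ ≤ δ) (hr : ρ + (α + β) * δ₀ ≤ ρ₁) (hρ₁δ : ρ₁ ≤ δ) (hρρ₁ : ρ ≤ ρ₁)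
    (hrepr : ∀ (v : 𝔸) (i : ι), |b.repr v i| ≤ M₂ * ‖v‖)
    (hdnn : ∀ a a' : g.Site, 0 ≤ g.dist a a') (htri : Triangle254 (toB6 g Rr H)) (hlen : ∀ y : g.Site, 0 < g.len y)
    (h261 : Ineq261 d (toB6 g Rr H) δ₀ β) (hT1 : ScaleTransfer g δ₀ α Λ₁ (fun a => g.len a)) (hT2 : ScaleTransfer g δ₀ α Λ₂ (fun a => g.len a ^ 2))
    (hsmall : ∀ y : g.Site, η * (α₁ * (g.len y)⁻¹) ≤ 1 / 4)
    (hA : ∀ μ x, ‖A μ x‖ ≤ α₁ * (g.len (blk x))⁻¹ ∧ ‖tauB T U μ (A μ) x‖ ≤ α₁ * (g.len (blk x))⁻¹)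
    (hA2 : ∀ μ ν x, ‖((η : ℂ))⁻¹ • covD T U μ (A ν) x‖ ≤ α₁ * (g.len (blk x) ^ 2)⁻¹)
    (hρu : ∀ μ x, ‖((U μ x : 𝔸ˣ) : 𝔸)‖ ≤ 1 ∧ ‖(((U μ x)⁻¹ : 𝔸ˣ) : 𝔸)‖ ≤ 1)
    (hd₀ : ∀ μ x, g.dist (blk x) (blk (T μ x)) ≤ d₀ ∧ g.dist (blk x) (blk ((T μ).symm x)) ≤ d₀)
    (hcomm : ∀ μ ν x, T μ (T ν x) = T ν (T μ x))
    (hplaq : ∀ (μ ν : κ) (x : S) (X : 𝔸), ‖R (U μ x * U ν (T μ x)) X - R (U ν x * U μ (T ν x)) X‖ ≤ cP * (η * (g.len (blk x))⁻¹) ^ 2 * ‖X‖)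
    (heta : ∀ y : g.Site, η ≤ g.len y) (k l : κ) {Gp : Module.End ℝ (S × ι → ℝ)}
    (hG : HasL2Majorant (g := toB6 g Rr H) (fun p : S × ι => blk p.1) Gp (fun a a' => B * g.len a ^ 2 * Real.exp (-(δ * g.dist a a'))))
    (hDGk : HasL2Majorant (g := toB6 g Rr H) (fun p : S × ι => blk p.1) (conj b (diffLetter T U (((η : ℂ))⁻¹) (Sum.inl k)) * Gp)
      (fun a a' => B * g.len a * Real.exp (-(δ * g.dist a a'))))
    (hDGl : HasL2Majorant (g := toB6 g Rr H) (fun p : S × ι => blk p.1) (conj b (diffLetter T U (((η : ℂ))⁻¹) (Sum.inl l)) * Gp)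
      (fun a a' => B * g.len a * Real.exp (-(δ * g.dist a a'))))
    (hDDG : HasL2Majorant (g := toB6 g Rr H) (fun p : S × ι => blk p.1)
      (conj b (diffLetter T U (((η : ℂ))⁻¹) (Sum.inl k)) * conj b (diffLetter T U (((η : ℂ))⁻¹) (Sum.inl l)) * Gp)
      (fun a a' => B * 1 * Real.exp (-(δ * g.dist a a')))) :
    HasL2Majorant (g := toB6 g Rr H) (fun p : S × ι => blk p.1)
      (conj b (diffLetter T (prodCfg U η A) (((η : ℂ))⁻¹) (Sum.inl k)) * conj b (diffLetter T (prodCfg U η A) (((η : ℂ))⁻¹) (Sum.inl l)) * Gp)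
      (fun a a' => (conv2ConstL cP M₂ (∑ i, ‖b i‖) (Real.sqrt (Fintype.card ι)) d₀ δ ρ₁ α₁ Λ₁ Λ₂ (B6.c1 d δ₀ β) * B) * 1 *
        Real.exp (-(ρ * g.dist a a'))) := by
  -- names
  set c : ℂ := ((η : ℂ))⁻¹ with hc
  set Dk := diffLetter T U c (Sum.inl k) with hDk
  set Dl := diffLetter T U c (Sum.inl l) with hDl
  set Wk := diffLetter T (prodCfg U η A) c (Sum.inl k) with hWk
  set Wl := diffLetter T (prodCfg U η A) c (Sum.inl l) with hWl
  set Sb : ℝ := ∑ i, ‖b i‖ with hSb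
  set sι : ℝ := Real.sqrt (Fintype.card ι) with hsι
  set c1 : ℝ := B6.c1 d δ₀ β with hc1
  have hSb0 : 0 ≤ Sb := Finset.sum_nonneg fun i _ => norm_nonneg _
  have hsι0 : 0 ≤ sι := Real.sqrt_nonneg _
  have hc10 : 0 ≤ c1 := B6RandomWalk.c1_nonneg d δ₀ β
  have hwi : ∀ a : g.Site, 0 ≤ (g.len a)⁻¹ := fun a => inv_nonneg.mpr (hlen a).le
  have hwi2 : ∀ a : g.Site, 0 ≤ (g.len a)⁻¹ ^ 2 := fun a => pow_nonneg (hwi a) _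
  have hw1 : ∀ a : g.Site, 0 ≤ g.len a := fun a => (hlen a).le
  have hw2 : ∀ a : g.Site, 0 ≤ g.len a ^ 2 := fun a => pow_nonneg (hw1 a) _
  have hrδ : ρ ≤ δ := hρρ₁.trans hρ₁δ
  have htri' : ∀ a b c : g.Site, g.dist a c ≤ g.dist a b + g.dist b c := fun a b c => htri a b c
  -- the defect letters `E_k`, `E_l` at rate `ρ₁` and the commutator `[∇_k, E_l]` at rate `ρ₁`
  have hEk := hasL2Majorant_diffLetter_prodCfg_sub b T U (Rr := Rr) (H := H) blk hη A 1 d₀ ρ₁ M₂ α₁ hα₁ hρ₁ hM₂ hrepr hlen hsmall hA hρu hd₀ (Sum.inl k)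
  have hEl := hasL2Majorant_diffLetter_prodCfg_sub b T U (Rr := Rr) (H := H) blk hη A 1 d₀ ρ₁ M₂ α₁ hα₁ hρ₁ hM₂ hrepr hlen hsmall hA hρu hd₀ (Sum.inl l)
  have hQm := hasL2Majorant_comm_inl b T U (Rr := Rr) (H := H) blk hη A d₀ ρ₁ M₂ hα₁ hcP hρ₁ hM₂ hrepr k l (hcomm k l) hρu hsmall hlen
    (fun μ y => (hA μ y).1) (hA2 k l) (hplaq k l) heta htri' hd₀
  -- (T3) `E_k·(∇^W_l·Gp)`: the first-order LEFT conversion at rate `ρ₁`, then [4] (2.141) with the transfer of `ℓ`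
  have hWlG := hasL2Majorant_diffLetter_prodCfg_mul b T U (Rr := Rr) (H := H) blk d hη A 1 d₀ M₂ α₁ δ₀ δ α β ρ₁ Λ₂ B
    (fun a => g.len a ^ 2) (fun a => g.len a) hw2 hw1 (fun a => le_of_eq (by rw [pow_two, inv_mul_cancel_left₀ (hlen a).ne'])) hα₁
    (hρ₁.trans hρ₁δ) hM₂ hB hΛ₂ hρ₁ hr₁ hρ₁δ hrepr hdnn htri hlen h261 hT2 hsmall hA hρu hd₀ (Sum.inl l) hG hDGl
  set B₁ : ℝ := (1 + (4 * (1 : ℝ) ^ 2 * M₂ * Sb * sι * Real.exp (δ * d₀)) * α₁ * Λ₂ * c1) * B with hB₁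
  have hB₁0 : 0 ≤ B₁ := by positivity
  have hWlGρ : HasL2Majorant (g := toB6 g Rr H) (fun p : S × ι => blk p.1) (conj b Wl * Gp) (fun a a' => B₁ * g.len a * Real.exp (-(ρ * g.dist a a'))) :=
    hasL2Majorant_rate_mono (R := Rr) (H := H) _ B₁ (fun a => g.len a) hB₁0 hw1 hρρ₁ hdnn hWlG
  have hT3 := hasL2Majorant_comp_decay (R := Rr) (H := H) (fun p : S × ι => blk p.1) d δ₀ α β ρ ρ₁ Λ₁ (cE M₂ Sb sι ρ₁ d₀ * α₁) B₁
    (fun a => (g.len a)⁻¹) (fun a => g.len a) hwi hw1 hΛ₁ (mul_nonneg (cE_nonneg hM₂ hSb0 hsι0 _ _) hα₁) hB₁0 hρ hr hdnn htri hT1 h261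
    (hasL2Majorant_mono (g := toB6 g Rr H) _ hEk fun a a' => le_of_eq (by simp only [cE]; ring)) hWlGρ
  -- (T1) `E_l·(∇_k·Gp)`
  have hDGkρ : HasL2Majorant (g := toB6 g Rr H) (fun p : S × ι => blk p.1) (conj b Dk * Gp) (fun a a' => B * g.len a * Real.exp (-(ρ * g.dist a a'))) :=
    hasL2Majorant_rate_mono (R := Rr) (H := H) _ B (fun a => g.len a) hB hw1 hrδ hdnn hDGk
  have hT1 := hasL2Majorant_comp_decay (R := Rr) (H := H) (fun p : S × ι => blk p.1) d δ₀ α β ρ ρ₁ Λ₁ (cE M₂ Sb sι ρ₁ d₀ * α₁) B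
    (fun a => (g.len a)⁻¹) (fun a => g.len a) hwi hw1 hΛ₁ (mul_nonneg (cE_nonneg hM₂ hSb0 hsι0 _ _) hα₁) hB hρ hr hdnn htri hT1 h261
    (hasL2Majorant_mono (g := toB6 g Rr H) _ hEl fun a a' => le_of_eq (by simp only [cE]; ring)) hDGkρ
  -- (T2) `[∇_k, E_l]·Gp`
  have hGρ : HasL2Majorant (g := toB6 g Rr H) (fun p : S × ι => blk p.1) Gp (fun a a' => B * g.len a ^ 2 * Real.exp (-(ρ * g.dist a a'))) :=
    hasL2Majorant_rate_mono (R := Rr) (H := H) _ B (fun a => g.len a ^ 2) hB hw2 hrδ hdnn hG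
  have hT2 := hasL2Majorant_comp_decay (R := Rr) (H := H) (fun p : S × ι => blk p.1) d δ₀ α β ρ ρ₁ Λ₂ (cQ cP M₂ Sb sι ρ₁ d₀ * α₁) B
    (fun a => (g.len a)⁻¹ ^ 2) (fun a => g.len a ^ 2) hwi2 hw2 hΛ₂ (mul_nonneg (cQ_nonneg hcP hM₂ hSb0 hsι0 _ _) hα₁) hB hρ hr hdnn htri hT2 h261
    (hasL2Majorant_mono (g := toB6 g Rr H) _ hQm fun a a' => le_of_eq (by simp only [cQ]; ring)) hGρ
  -- (T0) the base entry at the smaller rate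
  have hT0 : HasL2Majorant (g := toB6 g Rr H) (fun p : S × ι => blk p.1) (conj b Dk * conj b Dl * Gp) (fun a a' => B * 1 * Real.exp (-(ρ * g.dist a a'))) :=
    hasL2Majorant_rate_mono (R := Rr) (H := H) _ B (fun _ => 1) hB (fun _ => zero_le_one) hrδ hdnn hDDG
  -- `∇^W_k∇^W_l·Gp = ∇_k∇_l·Gp + E_l·(∇_k·Gp) + [∇_k, E_l]·Gp + E_k·(∇^W_l·Gp)`
  have hsplit : conj b Wk * conj b Wl * Gp
      = conj b Dk * conj b Dl * Gp + conj b (Wl - Dl) * (conj b Dk * Gp) + conj b (Dk * (Wl - Dl) - (Wl - Dl) * Dk) * Gp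
        + conj b (Wk - Dk) * (conj b Wl * Gp) := by
    simp only [conj_sub, B9Eq352DivFormLetters.conj_mul, mul_sub, sub_mul, mul_assoc]
    abel
  rw [hsplit]
  refine hasL2Majorant_mono (g := toB6 g Rr H) _
    (hasL2Majorant_add (g := toB6 g Rr H) _ (hasL2Majorant_add (g := toB6 g Rr H) _ (hasL2Majorant_add (g := toB6 g Rr H) _ hT0 hT1) hT2) hT3)
    fun a a' => ?_
  have hex : 0 ≤ Real.exp (-(ρ * g.dist a a')) := (Real.exp_pos _).le
  have hℓ : (g.len a)⁻¹ * g.len a = 1 := inv_mul_cancel₀ (hlen a).ne'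
  have hℓ2 : (g.len a)⁻¹ ^ 2 * g.len a ^ 2 = 1 := by rw [← mul_pow, hℓ, one_pow]
  rw [hℓ, hℓ2, hB₁]
  apply le_of_eq
  simp only [conv2ConstL, cE, hSb, hsι, hc1]
  ring

/-- ★★ **THE RIGHT SECOND-ORDER CONVERSION IN `L²`, `Gp·∇♯_{U,inr k}∇♯_{U,inr l} ↦ Gp·∇♯_{U′U,inr k}∇♯_{U′U,inr l}`** (backward letters, p. 403 l.1–9
with (3.74); the (3.46) member `G′∇*_U∇*_U`).  If `Gp ≺₂ Bℓ²e^{−δd}`, `Gp·∇♯_{inr k}, Gp·∇♯_{inr l} ≺₂ Bℓe^{−δd}` and `Gp·∇♯_{inr k}∇♯_{inr l} ≺₂ B·e^{−δd}`, then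
under the hypotheses of the LEFT conversion, the backward scale comparability `ℓ(y(x−e_μ−e_ν))⁻² ≦ σ₂ℓ(y(x))⁻²` and the scale transfers of `ℓ⁻¹` (`Λ′₁`) and
`ℓ⁻²` (`Λ′₂`): `Gp·∇♯_{U′U,inr k}∇♯_{U′U,inr l} ≺₂ K_R·B·e^{−ρd}` — from `G∇^W_k∇^W_l = G∇_k∇_l + (G∇_l)E_k − G[∇_l, E_k] + (G∇^W_k)E_l`.
[cite: Balaban1985BackgroundPropagators, p.403 l.1–9, (3.74) p.405, (3.46) p.398, (3.37) p.396; Balaban1984PropagatorsII, Prop. 2.6 (2.140)–(2.141) p.247, Lemma 2.1 p.234] -/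
theorem hasL2Majorant_mul_diffLetter2_prodCfg (blk : S → g.Site) (d : ℕ) {η : ℝ} (hη : 0 < η) (A : κ → S → 𝔸)
    (d₀ M₂ α₁ cP σ₂ δ₀ δ α β ρ₁ ρ Λ₁ Λ₂ B : ℝ)
    (hα₁ : 0 ≤ α₁) (hcP : 0 ≤ cP) (hσ₂ : 0 ≤ σ₂) (hM₂ : 0 ≤ M₂) (hB : 0 ≤ B) (hΛ₁ : 0 ≤ Λ₁) (hΛ₂ : 0 ≤ Λ₂) (hρ : 0 ≤ ρ) (hρ₁ : 0 ≤ ρ₁)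
    (hr₁ : ρ₁ + (α + β) * δ₀ ≤ δ) (hr : ρ + (α + β) * δ₀ ≤ ρ₁) (hρ₁δ : ρ₁ ≤ δ) (hρρ₁ : ρ ≤ ρ₁)
    (hrepr : ∀ (v : 𝔸) (i : ι), |b.repr v i| ≤ M₂ * ‖v‖)
    (hdnn : ∀ a a' : g.Site, 0 ≤ g.dist a a') (htri : Triangle254 (toB6 g Rr H)) (hlen : ∀ y : g.Site, 0 < g.len y)
    (h261 : Ineq261 d (toB6 g Rr H) δ₀ β) (hTi1 : ScaleTransfer g δ₀ α Λ₁ (fun a => (g.len a)⁻¹))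
    (hTi2 : ScaleTransfer g δ₀ α Λ₂ (fun a => (g.len a)⁻¹ ^ 2))
    (hsmall : ∀ y : g.Site, η * (α₁ * (g.len y)⁻¹) ≤ 1 / 4)
    (hA : ∀ μ x, ‖A μ x‖ ≤ α₁ * (g.len (blk x))⁻¹ ∧ ‖tauB T U μ (A μ) x‖ ≤ α₁ * (g.len (blk x))⁻¹)
    (hA2 : ∀ μ ν x, ‖((η : ℂ))⁻¹ • covD T U μ (A ν) x‖ ≤ α₁ * (g.len (blk x) ^ 2)⁻¹)
    (hρu : ∀ μ x, ‖((U μ x : 𝔸ˣ) : 𝔸)‖ ≤ 1 ∧ ‖(((U μ x)⁻¹ : 𝔸ˣ) : 𝔸)‖ ≤ 1)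
    (hd₀ : ∀ μ x, g.dist (blk x) (blk (T μ x)) ≤ d₀ ∧ g.dist (blk x) (blk ((T μ).symm x)) ≤ d₀)
    (hcomm : ∀ μ ν x, T μ (T ν x) = T ν (T μ x))
    (hplaq : ∀ (μ ν : κ) (x : S) (X : 𝔸), ‖R (U μ x * U ν (T μ x)) X - R (U ν x * U μ (T ν x)) X‖ ≤ cP * (η * (g.len (blk x))⁻¹) ^ 2 * ‖X‖)
    (hσ : ∀ (μ ν : κ) (x : S), (g.len (blk ((T ν).symm ((T μ).symm x))))⁻¹ ^ 2 ≤ σ₂ * (g.len (blk x))⁻¹ ^ 2)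
    (heta : ∀ y : g.Site, η ≤ g.len y) (k l : κ) {Gp : Module.End ℝ (S × ι → ℝ)}
    (hG : HasL2Majorant (g := toB6 g Rr H) (fun p : S × ι => blk p.1) Gp (fun a a' => B * g.len a ^ 2 * Real.exp (-(δ * g.dist a a'))))
    (hGDk : HasL2Majorant (g := toB6 g Rr H) (fun p : S × ι => blk p.1) (Gp * conj b (diffLetter T U (((η : ℂ))⁻¹) (Sum.inr k)))
      (fun a a' => B * g.len a * Real.exp (-(δ * g.dist a a'))))
    (hGDl : HasL2Majorant (g := toB6 g Rr H) (fun p : S × ι => blk p.1) (Gp * conj b (diffLetter T U (((η : ℂ))⁻¹) (Sum.inr l)))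
      (fun a a' => B * g.len a * Real.exp (-(δ * g.dist a a'))))
    (hGDD : HasL2Majorant (g := toB6 g Rr H) (fun p : S × ι => blk p.1)
      (Gp * conj b (diffLetter T U (((η : ℂ))⁻¹) (Sum.inr k)) * conj b (diffLetter T U (((η : ℂ))⁻¹) (Sum.inr l)))
      (fun a a' => B * 1 * Real.exp (-(δ * g.dist a a')))) :
    HasL2Majorant (g := toB6 g Rr H) (fun p : S × ι => blk p.1)
      (Gp * conj b (diffLetter T (prodCfg U η A) (((η : ℂ))⁻¹) (Sum.inr k)) * conj b (diffLetter T (prodCfg U η A) (((η : ℂ))⁻¹) (Sum.inr l)))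
      (fun a a' => (conv2ConstR cP σ₂ M₂ (∑ i, ‖b i‖) (Real.sqrt (Fintype.card ι)) d₀ ρ₁ ρ α₁ Λ₁ Λ₂ (B6.c1 d δ₀ β) * B) * 1 *
        Real.exp (-(ρ * g.dist a a'))) := by
  -- names
  set c : ℂ := ((η : ℂ))⁻¹ with hc
  set Dk := diffLetter T U c (Sum.inr k) with hDk
  set Dl := diffLetter T U c (Sum.inr l) with hDl
  set Wk := diffLetter T (prodCfg U η A) c (Sum.inr k) with hWk
  set Wl := diffLetter T (prodCfg U η A) c (Sum.inr l) with hWl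
  set Sb : ℝ := ∑ i, ‖b i‖ with hSb
  set sι : ℝ := Real.sqrt (Fintype.card ι) with hsι
  set c1 : ℝ := B6.c1 d δ₀ β with hc1
  have hSb0 : 0 ≤ Sb := Finset.sum_nonneg fun i _ => norm_nonneg _
  have hsι0 : 0 ≤ sι := Real.sqrt_nonneg _
  have hc10 : 0 ≤ c1 := B6RandomWalk.c1_nonneg d δ₀ β
  have hwi : ∀ a : g.Site, 0 ≤ (g.len a)⁻¹ := fun a => inv_nonneg.mpr (hlen a).le
  have hwi2 : ∀ a : g.Site, 0 ≤ (g.len a)⁻¹ ^ 2 := fun a => pow_nonneg (hwi a) _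
  have hw1 : ∀ a : g.Site, 0 ≤ g.len a := fun a => (hlen a).le
  have hw2 : ∀ a : g.Site, 0 ≤ g.len a ^ 2 := fun a => pow_nonneg (hw1 a) _
  have hrδ : ρ ≤ δ := hρρ₁.trans hρ₁δ
  have htri' : ∀ a b c : g.Site, g.dist a c ≤ g.dist a b + g.dist b c := fun a b c => htri a b c
  -- the defect letters at rate `ρ` and the commutator `[∇*_l, E*_k]` at rate `ρ`
  have hEk := hasL2Majorant_diffLetter_prodCfg_sub b T U (Rr := Rr) (H := H) blk hη A 1 d₀ ρ M₂ α₁ hα₁ hρ hM₂ hrepr hlen hsmall hA hρu hd₀ (Sum.inr k)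
  have hEl := hasL2Majorant_diffLetter_prodCfg_sub b T U (Rr := Rr) (H := H) blk hη A 1 d₀ ρ M₂ α₁ hα₁ hρ hM₂ hrepr hlen hsmall hA hρu hd₀ (Sum.inr l)
  have hQm := hasL2Majorant_comm_inr b T U (Rr := Rr) (H := H) blk hη A d₀ ρ M₂ hα₁ hcP hσ₂ hρ hM₂ hrepr l k (hcomm l k) hρu hsmall hlen
    (fun μ y => (hA μ y).1) (hA2 l k) (hplaq l k) heta htri' hd₀ (hσ l k)
  -- (T3') `(Gp·∇*^W_k)·E*_l`: the first-order RIGHT conversion at rate `ρ₁`, then [4] (2.141) with the transfer of `ℓ⁻¹`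
  have hGWk := hasL2Majorant_mul_diffLetter_prodCfg b T U (Rr := Rr) (H := H) blk d hη A 1 d₀ M₂ α₁ δ₀ δ α β ρ₁ Λ₁ B
    (fun a => g.len a ^ 2) (fun a => g.len a) hw2 hw1 (fun a => le_of_eq (by rw [pow_two, mul_inv_cancel_right₀ (hlen a).ne'])) hα₁
    hM₂ hB hΛ₁ hρ₁ hr₁ hρ₁δ hrepr hdnn htri hlen h261 hTi1 hsmall hA hρu hd₀ (Sum.inr k) hG hGDk
  set B₁ : ℝ := (1 + (4 * (1 : ℝ) ^ 2 * M₂ * Sb * sι * Real.exp (ρ₁ * d₀)) * α₁ * Λ₁ * c1) * B with hB₁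
  have hB₁0 : 0 ≤ B₁ := by positivity
  have hT3 := hasL2Majorant_comp_decay (R := Rr) (H := H) (fun p : S × ι => blk p.1) d δ₀ α β ρ ρ₁ Λ₁ B₁ (cE M₂ Sb sι ρ d₀ * α₁)
    (fun a => g.len a) (fun a => (g.len a)⁻¹) hw1 hwi hΛ₁ hB₁0 (mul_nonneg (cE_nonneg hM₂ hSb0 hsι0 _ _) hα₁) hρ hr hdnn htri hTi1 h261 hGWk
    (hasL2Majorant_mono (g := toB6 g Rr H) _ hEl fun a a' => le_of_eq (by simp only [cE]; ring))
  -- (T1') `(Gp·∇*_l)·E*_k`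
  have hGDlρ : HasL2Majorant (g := toB6 g Rr H) (fun p : S × ι => blk p.1) (Gp * conj b Dl) (fun a a' => B * g.len a * Real.exp (-(ρ₁ * g.dist a a'))) :=
    hasL2Majorant_rate_mono (R := Rr) (H := H) _ B (fun a => g.len a) hB hw1 hρ₁δ hdnn hGDl
  have hT1 := hasL2Majorant_comp_decay (R := Rr) (H := H) (fun p : S × ι => blk p.1) d δ₀ α β ρ ρ₁ Λ₁ B (cE M₂ Sb sι ρ d₀ * α₁)
    (fun a => g.len a) (fun a => (g.len a)⁻¹) hw1 hwi hΛ₁ hB (mul_nonneg (cE_nonneg hM₂ hSb0 hsι0 _ _) hα₁) hρ hr hdnn htri hTi1 h261 hGDlρ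
    (hasL2Majorant_mono (g := toB6 g Rr H) _ hEk fun a a' => le_of_eq (by simp only [cE]; ring))
  -- (T2') `Gp·[∇*_l, E*_k]`
  have hGρ₁ : HasL2Majorant (g := toB6 g Rr H) (fun p : S × ι => blk p.1) Gp (fun a a' => B * g.len a ^ 2 * Real.exp (-(ρ₁ * g.dist a a'))) :=
    hasL2Majorant_rate_mono (R := Rr) (H := H) _ B (fun a => g.len a ^ 2) hB hw2 hρ₁δ hdnn hG
  have hT2 := hasL2Majorant_comp_decay (R := Rr) (H := H) (fun p : S × ι => blk p.1) d δ₀ α β ρ ρ₁ Λ₂ B (cQ cP M₂ Sb sι ρ d₀ * σ₂ * α₁)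
    (fun a => g.len a ^ 2) (fun a => (g.len a)⁻¹ ^ 2) hw2 hwi2 hΛ₂ hB
    (mul_nonneg (mul_nonneg (cQ_nonneg hcP hM₂ hSb0 hsι0 _ _) hσ₂) hα₁) hρ hr hdnn htri hTi2 h261 hGρ₁
    (hasL2Majorant_mono (g := toB6 g Rr H) _ hQm fun a a' => le_of_eq (by simp only [cQ]; ring))
  -- (T0') the base entry at the smaller rate
  have hT0 : HasL2Majorant (g := toB6 g Rr H) (fun p : S × ι => blk p.1) (Gp * conj b Dk * conj b Dl) (fun a a' => B * 1 * Real.exp (-(ρ * g.dist a a'))) :=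
    hasL2Majorant_rate_mono (R := Rr) (H := H) _ B (fun _ => 1) hB (fun _ => zero_le_one) hrδ hdnn hGDD
  -- `Gp·∇^W_k∇^W_l = Gp·∇_k∇_l + (Gp·∇_l)·E_k − Gp·[∇_l, E_k] + (Gp·∇^W_k)·E_l`
  have hsplit : Gp * conj b Wk * conj b Wl
      = Gp * conj b Dk * conj b Dl + Gp * conj b Dl * conj b (Wk - Dk) + -(Gp * conj b (Dl * (Wk - Dk) - (Wk - Dk) * Dl))
        + Gp * conj b Wk * conj b (Wl - Dl) := by
    simp only [conj_sub, B9Eq352DivFormLetters.conj_mul, mul_sub, sub_mul, mul_assoc, neg_sub]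
    abel
  rw [hsplit]
  refine hasL2Majorant_mono (g := toB6 g Rr H) _
    (hasL2Majorant_add (g := toB6 g Rr H) _ (hasL2Majorant_add (g := toB6 g Rr H) _ (hasL2Majorant_add (g := toB6 g Rr H) _ hT0 hT1)
      (hasL2Majorant_neg _ hT2)) hT3)
    fun a a' => ?_
  have hℓ : g.len a * (g.len a)⁻¹ = 1 := mul_inv_cancel₀ (hlen a).ne'
  have hℓ2 : g.len a ^ 2 * (g.len a)⁻¹ ^ 2 = 1 := by rw [← mul_pow, hℓ, one_pow]
  rw [hℓ, hℓ2, hB₁]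
  apply le_of_eq
  simp only [conv2ConstR, cE, cQ, hSb, hsι, hc1]
  ring

end LeftRight

end Literature.MathematicalPhysics.QuantumFieldTheory.Balaban1983to89.B9Eq370SecondOrderConversionL2

end
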